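import Literature.MathematicalPhysics.QuantumFieldTheory.Balaban1983to89.B4Ineq111ZeroNestEta
import Literature.MathematicalPhysics.QuantumFieldTheory.Balaban1983to89.B4Thm19ZeroBoxNegAlpha

/-!
# `Balaban1983to89.B4Ineq112ZeroNestNegFace` — B4 THEOREM p. 573, THE `δG` HÖLDER CLAUSE (1.11)·(1.12)·(1.9): IN
# b04's VERBATIM ZERO-FIELD CARRIER `zeroFieldSettingB` THE TYPED `B4.Ineq111_112` FAILS ON NESTED BOXES FOR EVERY
# `α > 0` — A KERNEL REFUTATION (nodes 12/13's OBSERVATION (O-bond) certified), AND THE CONVENTION DICHOTOMY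
# «bond convention `nestFam` TRUE ∧ verbatim `nestFamB` FALSE» FOR THE RESTRICTED LEAF `ThmPrintedNN` (`0 ≤ α < 1`)

**Source.** T. Bałaban, *Regularity and Decay of Lattice Green's Functions*, Commun. Math. Phys. **89**, 571–597
(1983) (bib key `Balaban1983RegularityDecay`, «B4»): p. 572 [PDF 2] (1.6); p. 573 [PDF 3] the Theorem («Proposition
2.1 of [1]») with (1.9)–(1.12) and its last sentence on rectangular parallelepipeds.  Quoted from the page renders
`b2b-balaban-ref1/pages/1983-cmp89-regularity-decay/1983-cmp89-regularity-decay-p002-x2.png`, `…-p003-x2.png` (read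
as images, not from the OCR text); the print's `≦` is written `≤`.

## WHAT IS PRINTED (verbatim from the renders)

p. 572: «G_k(Ω, A) = (−Δ^{η,N}_{A,Ω} + m² + aP_k(A))^{−1},   (1.6)  where m² ≥ 0 and a is a positive constant close
to 1.»

p. 573, Theorem (Proposition 2.1 of [1]): «For α < 1 there exist positive constants δ₀, c₀, R₀ independent of
A, k, Ω and depending on d, M only, c₀ on α also, such that for e sufficiently small and for an arbitrary function
f : Ω → R^N, we have |x − x′|^{−α} |U(A(Γ_{x,x′}))(D^η_{A,μ}G_k(Ω, A)f)(x′) − (D^η_{A,μ}G_k(Ω, A)f)(x)|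
≤ c₀ exp(−δ₀ dist({x, x′}, supp f))‖f‖_∞   (1.9) for x, x′ ∈ Ω, and satisfying the condition
dist({x, x′}, Ω^c) ≥ R₀.» … «If Ω ⊂ Ω₀, then for δG_k(Ω, Ω₀, A) defined by the equality
δG_k(Ω, Ω₀, A) = G_k(Ω, A) − G_k(Ω₀, A),   (1.11)  we have the inequalities (1.5) and (1.6)» ⟦sic: (1.9) and
(1.10) are meant⟧ «(with the same restrictions on x, x′) with the additional factor
exp(−δ₀ dist(supp f, Ω^c) − δ₀ dist(supp f, Ω^c))   (1.12)  on the right hand sides.» … «For some simple sets Ω,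
e.g. for rectangular parallelepipeds, the inequalities hold without any restrictions on the points x, x′, i.e. for
all x, x′ ∈ Ω.»

The cell's typed clause (b04, `B4.Ineq111_112 S α δ₀ c₀ R₀`, untouched; first conjunct) reads, over an abstract
carrier `S : EtaSetting`: `∀ μ f x x′, (S.rect ∨ R₀ ≤ S.bdist2 x x′) → S.dlhs19 α μ f x x′ ≤ c₀ · exp(−δ₀·S.sdist2 x x′ f)
· exp(−(δ₀·S.bdist2 x x′ + δ₀·S.bdistS f)) · S.supNorm f`; b04's concrete zero-field carrier `zeroFieldSettingB a Mb g`
(`B4Cor23ZeroEta`, untouched) instantiates `dlhs19 α μ f x x′ := |x − x′|_η^{−α} · |fdiff μ (δG f) x′ − fdiff μ (δG f) x|`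
with `B4Cor23Zero.fdiff n R μ ψ x = η^{−1}(ψ(x + e_μ) − ψ(x))` if the bond `⟨x, x + e_μ⟩` lies in `Ω` and `= 0` OTHERWISE
— at EVERY pair of points of `Ω`, with no guard that both forward bonds lie in `Ω`.

## WHAT IS CERTIFIED (HONEST SCOPE)

THE CASE `A = 0` (`U ≡ 1`, `D^η_{0,μ}`), mass `m² = 0`, for the operator (1.6) `G_k(Ω,0) = (−Δ^{η,N}_Ω + aP_k)^{-1}`
(b04's `(fineOpR n a m² R)⁻¹`), `Ω ⊂ Ω₀` NESTED BOXES of big blocks, read on node 13's ZERO-FIELD NESTED-BOX FAMILY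
`NestInst d ℓ m²₊` (`B4Ineq111ZeroNestEta`; mesh `η = L^{-k}`, `L = ℓ + 1 ≥ 2`, fine side of a unit block `n = L^k`)
through b04's VERBATIM carrier `nestFamB ℓ m²₊ a Mb g i = zeroFieldSettingB a Mb g i.toZF` — b04's files untouched.

* THE MEMBER AND ITS FIELD (§5).  `slab`: scale `k ≥ 1`, direction `μ`, `Ω = [0, Mb)^{d+1}` = ONE big block (fine
  points `[0, nMb)^{d+1}`), `Ω₀ = Ω ∪ (Ω + Mb·e_μ)` (two big blocks along `μ`; `M₀ = dblM Mb μ`), offset `0`, mass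
  `0`, any charge `e`; it meets EVERY typed antecedent — `regular` (void at `A = 0`), `bigBlocks`, `rect`, `e = e₁`
  (`slab_hypotheses`, `slab_rect`), and `Ω₀∖Ω ≠ ∅` (`slab_outR_nonempty`).  SOURCE `f := 1` on `Ω`.  Then
  `δG_k(Ω,Ω₀,0)1 = G_k(Ω,0)1 − (G_k(Ω₀,0)1_Ω)|_Ω = 1/a − u|_Ω` with `u := G_k(Ω₀,0)1_Ω` (`dG9_one_apply`: the row
  sums of `−Δ^{η,N} + aP_k` are `a`, `boxGreen_one`; node 13's `NestInst.dG_eq` identifies b04's `δG` of the member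
  with the lineage's `B4Delta112ZeroBox.dG` of the pair).
* THE ANALYSIS (§3–§4, the new mathematics of the file; elementary, on the outer box `Ω₀` with `Ω_m := {y_μ < nm}`,
  `u := G_k(Ω₀,0)1_{Ω_m}`, `ε := 1/(2(1+a))`).  ENERGY BOUND `energy_bound`: `a⟨1_{Ω_m}, u⟩ ≤ |Ω_m| − ε·|B_in|`,
  `B_in` = the fine points of the last unit-block layer of `Ω_m` (decompose `1_{Ω_m} = h + r`, `h` block-constant,
  `r = ε(1_{B_in} − 1_{B_out})`; AM–GM of `⟨h, u⟩` against the block term `a·n^{−(d+1)}Σ_b(Σ_b u)²` of the form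
  `⟨u, (−Δ + aP_k)u⟩ = ⟨1_{Ω_m}, u⟩` (`form_eq_pairing`, `block_pairing_le`), and of `⟨r, u⟩` against the bond term
  through `μ`-column telescoping over one unit block (`face_pairing_le`, `bond_sum_le`)).  LAYER IDENTITY
  `layer_identity` (Green's identity `⟨(−Δ + aP_k)u, v⟩ = ⟨1_{Ω_m}, v⟩` with the test function
  `v = 1_{y_μ ≤ nm − 2}`; `lap_vfun`): `n²·Σ_{x : x_μ = nm−2}(u(x) − u(x + e_μ)) + a⟨1_{Ω_m}, u⟩ − a⟨u, P_k 1_{x_μ = nm−1}⟩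
  = |Ω_m| − |layer|`.  With a sup bound `|u| ≤ C` (`lay_block_sum_le`) these give `exists_face_drop`: SOME `x′` with
  `x′_μ = nm − 2` has `u(x′) − u(x′ + e_μ) ≥ (εn − 1 − aC)/n²` — the inward normal derivative of `u` one layer inside
  the face `{y_μ = nm − 1}` of `Ω_m` is `≥ (εn − 1 − aC)/n` on average.  The sup bound, UNIFORM IN THE MESH, is node
  12's `η`-uniform (1.10) value bound `valG_bound` on the box `Ω₀` with `‖1_Ω‖_∞ ≤ 1` (`exists_sol_bound`,
  `C = C(d, L, a)`).
* THE VIOLATED CLAUSE (§6).  At the pair `x′` (of `exists_face_drop`, `m = Mb`) and `x := x′ + e_μ` ON THE FACE of `Ω`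
  adjacent to `Ω₀∖Ω`: the bond `⟨x′, x⟩` lies in `Ω`, so `fdiff μ (δG 1) x′ = n·(u(x′) − u(x)) ≥ (εn − 1 − aC)/n`, while
  the forward bond at `x` LEAVES `Ω`, so the typed `fdiff μ (δG 1) x = 0`; `|x − x′|_η = η`, weight `η^{−α} = n^α`:
  `dlhs19 ≥ n^α·(εn − 1 − aC)/n` (`dlhs19_slab_ge`).  The right side is `≤ |c₀|` for every `δ₀ ≥ 0` and every
  boundary assignment `g ≥ 0` (both exponentials `≤ 1`, `‖1‖_∞ ≤ 1`; `rhs112_slab_le`).  Hence for `n ≥ 4(1+a)(1+aC)`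
  and `n^α > 4(1+a)|c₀|` — available for every `α > 0` at a fine enough mesh (`exists_scale`) — the typed
  `Ineq111_112` FAILS on the member (`ineq112_slab_fails`, `exists_member_violating`: for EVERY `α > 0`, `δ₀ ≥ 0`,
  `c₀`, `R₀`, `e₁` a member with `e = e₁` meeting the antecedents and violating it; `leafClause_fails`).
* THE REFUTATIONS (§6).  For every `L ≥ 2`, `a > 0`, `m²₊ ≥ 0`, `Mb ≥ 1` and boundary assignment `g ≥ 0`:
  `¬ ThmPrintedNN (nestFamB ℓ m²₊ a Mb g)` (node 13's restricted leaf, `0 ≤ α < 1`, BOTH conjuncts; its clause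
  `α = 1/2` fails — `not_thmPrintedNN_nestFamB`), hence `¬ ThmPrinted (nestFamB …)` (`not_thmPrinted_nestFamB`); and
  over b04's OWN index type `ZeroFieldInstance d` (the refuting member is the image `i.toZF`, `L = 2`, `m² = 0`):
  `¬ ThmPrintedNN (zeroFieldSettingB a Mb g)` for every `a > 0`, `Mb ≥ 1`, `g ≥ 0`, in particular for b04's default
  carrier `¬ ThmPrintedNN (zeroFieldSetting a Mb)` (`g = dist_η(supp f, Ω₀∖Ω) ≥ 0`, `bdist_nonneg`).
* THE CONVENTION DICHOTOMY (§6, with node 13): with the default `g = bdist` (admissible AND nonnegative)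
  `ThmPrintedNN (nestFam ℓ m²₊ a Mb bdist) ∧ ¬ ThmPrintedNN (nestFamB ℓ m²₊ a Mb bdist)` (`convention_dichotomy` ←
  node 13's `thmPrintedNN_nestFam`): the two carriers have identical fields except the Hölder fields `lhs19`/`dlhs19`
  (node 12's bond convention `holderQ` reads (1.9) on pairs of BONDS of `Ω`; b04's verbatim field on pairs of POINTS,
  with `fdiff := 0` where the forward bond leaves `Ω`).  Non-vacuity at `d + 1 = 4`, `L = 2`, `a = 1`, `Mb = 1` (§7).
* THE READING (for b04 / the carver; analysis-level commentary, the kernel facts are the items above).  This is a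
  statement about the TYPED TRANSCRIPTION, not against the paper: the print's `D^η_{A,μ}f` is a function on BONDS
  `⟨x, x + ηe_μ⟩ ⊂ Ω` (the covariant lattice derivative), and (1.9)/(1.11) compare it at two bonds of `Ω`.  b04's
  carrier extends it by `0` to points whose forward bond leaves `Ω` and lets `x, x′` range over all points; at a
  face of `Ω` INTERIOR to `Ω₀` this pairs a genuine normal derivative of `G_k(Ω₀,0)1_Ω` — of size `≥ ε/2` uniformly
  in the mesh, by the energy/layer estimate above — with an artificial `0` at distance `η`, under the weight
  `η^{−α} → ∞`.  So the typed (1.11)·(1.9) in the verbatim carrier fails for every `α > 0` already at zero field,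
  while the printed bond statement (node 13, bond convention, certified TRUE on the same family) is not in doubt.
  Consequently NO faithful discharge of `B4.Ineq111_112`'s Hölder clause — hence of `LeafB4` through b04's
  `DagBinding` — is possible in `zeroFieldSettingB`/`zeroFieldSetting` on any family containing these nested pairs
  at unbounded scale; the natural repair — NOT made here — is node 12's guarded field (`zeroFieldSettingBond`).

NOT certified / not claimed: anything at `A ≠ 0`; the case `α = 0` of the verbatim clause (the violated instance
needs `n^α → ∞`; at `α = 0` the left side stays bounded and nothing is claimed either way); masses `m² > 0` (the
member has `m² = 0 ∈ [0, m²₊]`, which suffices to refute the family statement for every ceiling `m²₊ ≥ 0`); regions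
other than the nested boxes `slab`; boundary assignments `g` with negative values (b04's admissibility is an UPPER
bound `g ≤ bdist`; the refutation needs the LOWER bound `0 ≤ g`, met by the default `bdist`); the (1.9)–(1.10)
conjunct `Ineq19_110` and the two non-Hölder clauses of `Ineq111_112` play no role (they HOLD verbatim on boxes, nodes
12–14); the positivity of `c₀, R₀, e₁` is not used, `δ₀` enters only through `exp(−δ₀·…) ≤ 1`.  The constants of
the violated instance depend on `d, L, a` (through node 12's `valG_bound`) as everywhere in this lineage.

DICTIONARY (print ↦ Lean, all from b04 / nodes 9, 12, 13): `Ω ⊂ Ω₀` ↦ inner `boxDom (fun _ ↦ L^k·Mb)` ⊂ outer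
`shiftBox L^k (dblM Mb μ) 0 = boxDom (fun j ↦ L^k·dblM Mb μ j)` (`slab`, `NestInst.toZF`); `G_k(Ω,0)`, `G_k(Ω₀,0)` ↦
`(fineOpR n a 0 R)⁻¹` (`= (boxOpR n a 0 M)⁻¹` on boxes, `fineOpR_boxDom`); `δG_k(Ω,Ω₀,0)f` ↦ b04's
`B4Cor23ZeroDelta.dG n a m² hsub f = G(Ω)f − (G(Ω₀)f̃)|_Ω` = (node 13 `NestInst.dG_eq`) node 9's `B4Delta112ZeroBox.dG`;
`1_Ω` extended by zero ↦ `B4Delta112ZeroBox.ext … 1 = ind` (`ext_one_eq_ind`); `u = G_k(Ω₀,0)1_Ω` ↦ `sol n a M₀ μ Mb`;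
`D^η_{0,μ}` ↦ `fdiff n R μ`; `|x − x′|` ↦ `edistR n R` (`η`-scaled sup-distance); `‖f‖_∞` ↦ `ZeroFieldInstance.supN`;
`dist({x,x′}, supp f)` ↦ `sdist2`; the factor (1.12) ↦ `exp(−(δ₀·bdist2 x x′ + δ₀·bdistS f))`, `bdistS f = g i f`;
`U(A(Γ)) ↦ 1`; (1.11)·(1.12) ↦ `B4.Ineq111_112`; the Theorem ↦ `B4.ThmPrinted`, its `0 ≤ α < 1` restriction ↦ node 13's
`ThmPrintedNN`.

DEPENDENCIES (kernel-proved tree modules only; no Literature fact is minted, no hypothesis is assumed): node 13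
`B4Ineq111ZeroNestEta` (`NestInst`, `toZF`, `nestFam`, `nestFamB`, `NestInst.dG_eq`, `shiftBox`,
`shiftBox_isBlockUnion_of_dvd`, `boxDom_isBlockUnion_of_dvd`, `ThmPrintedNN`, `thmPrintedNN_of_thmPrinted`,
`thmPrintedNN_nestFam`, `bdist_admissible`), node 16 `B4Thm19ZeroBoxNegAlpha` (`supN_le_of_forall_le`, `two_le_Lk`),
node 12 `B4Ineq19ZeroBoxEta` (`BoxInst`, `BoxInst.rect`, `valG_bound`, `supN_nonneg`, `setDist_edistR_nonneg`), node 9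
`B4Delta112ZeroBox` (`dG`, `ext`, `ext_of_mem`, `ext_of_not_mem`), b04's `B4` (`ThmPrinted`, `Ineq19_110`,
`Ineq111_112`, `EtaSetting`), `B4Cor23ZeroEta` (`ZeroFieldInstance`, `zeroFieldSettingB`, `zeroFieldSetting`),
`B4Cor23ZeroDelta` (`dG`, `setDist`, `bdist`, `outR`), `B4Cor23Zero` (`fdiff`, `supp`), `B4Lower18` (`fineOpR`,
`fineOpR_form`, `fineOpR_mul_inv`, `fineOpR_inv_mul`, `fineOpR_isSymm`, `boxDom_isBlockUnion`, `edistR`, `rblk`),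
`B4TwoBox120` (`Fits`, `emb`), `B4Reflection242` (`boxDom`, `blk`, `nbrs`, `diagK`, `avgK`), `B4BoxCov237` (`boxOpR`,
`uvec`, `card_filter_blk`), `B4ContourShift` (`supNorm`); Mathlib otherwise.

VERSIONS: v1 (this file).

Value = kernel certificate of a TYPING DEFECT of b04's verbatim zero-field carrier for the Hölder clause of the
cell's `B4.Ineq111_112` (the unguarded field `dlhs19` at a face of `Ω` interior to `Ω₀`), with an explicit
zero-field counterexample resting on an elementary energy/layer estimate for `G_k(Ω₀,0)1_Ω`, and the matching
convention dichotomy with node 13; negative knowledge for b04 / the carver; NOT summit progress and NOT a claim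
against B4's Theorem.
-/

namespace Literature.MathematicalPhysics.QuantumFieldTheory.Balaban1983to89.B4Ineq112ZeroNestNegFace

open Finset Matrix
open Literature.MathematicalPhysics.QuantumFieldTheory.Balaban1983to89.B4 (EtaSetting Ineq19_110 Ineq111_112
  ThmPrinted)
open Literature.MathematicalPhysics.QuantumFieldTheory.Balaban1983to89.B4ContourShift (supNorm supNorm_nonneg
  abs_le_supNorm)
open Literature.MathematicalPhysics.QuantumFieldTheory.Balaban1983to89.B4Reflection242 (boxDom mem_boxDom blk diagK
  avgK nbrs mem_nbrs not_mem_nbrs_self blk_mem_boxDom)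
open Literature.MathematicalPhysics.QuantumFieldTheory.Balaban1983to89.B4BoxCov237 (boxOpR uvec uvec_apply_same
  uvec_apply_ne card_filter_blk)
open Literature.MathematicalPhysics.QuantumFieldTheory.Balaban1983to89.B4Lower18 (fineOpR fineOpR_boxDom
  IsBlockUnion boxDom_isBlockUnion edistR neumannLapR regionOpR rblk card_filter_rblk fineOpR_form fineOpR_mul_inv
  fineOpR_inv_mul fineOpR_isSymm supNorm_sub_le_one_of_mem_nbrs)
open Literature.MathematicalPhysics.QuantumFieldTheory.Balaban1983to89.B4TwoBox120 (Fits Fits.scale emb emb_val)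
open Literature.MathematicalPhysics.QuantumFieldTheory.Balaban1983to89.B4Cor23Zero (fdiff fdiff_of_mem
  fdiff_of_not_mem supp)
open Literature.MathematicalPhysics.QuantumFieldTheory.Balaban1983to89.B4Cor23ZeroDelta (setDist outR incl bdist)
open Literature.MathematicalPhysics.QuantumFieldTheory.Balaban1983to89.B4Cor23ZeroEta (ZeroFieldInstance
  zeroFieldSettingB zeroFieldSetting)
open Literature.MathematicalPhysics.QuantumFieldTheory.Balaban1983to89.B4Ineq19ZeroBoxEta (BoxInst boxFam boxFamB
  setDist_edistR_nonneg valG_bound supN_nonneg abs_le_supN zeroFieldSettingBond ThmPrinted19NN)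
open Literature.MathematicalPhysics.QuantumFieldTheory.Balaban1983to89.B4Ineq111ZeroNestEta (shiftBox mem_shiftBox
  box_subset_shiftBox shiftBox_isBlockUnion_of_dvd boxDom_isBlockUnion_of_dvd NestInst nestFam nestFamB ThmPrintedNN
  thmPrintedNN_nestFam thmPrintedNN_of_thmPrinted bdist_admissible)
open Literature.MathematicalPhysics.QuantumFieldTheory.Balaban1983to89.B4Thm19ZeroBoxNegAlpha (supN_le_of_forall_le two_le_Lk)

noncomputable section

variable {d : ℕ}

/-! ## §1 Two elementary inequalities and the action of the operator `−Δ^{η,N}_Ω + m² + aP_k` on a function -/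

/-- weighted AM–GM: `pq ≤ p²/(2t) + tq²/2`. [folklore] -/
theorem am_gm {p q t : ℝ} (ht : 0 < t) : p * q ≤ p ^ 2 / (2 * t) + t * q ^ 2 / 2 := by
  have h0 : 0 ≤ (p - t * q) ^ 2 / (2 * t) := by positivity
  have e : p ^ 2 / (2 * t) + t * q ^ 2 / 2 - p * q = (p - t * q) ^ 2 / (2 * t) := by
    field_simp
    ring
  linarith

/-- `|Σ_{s} u| ≤ #s · C` under a uniform bound `|u| ≤ C`. [folklore] -/
theorem abs_sum_le_card_mul {ι : Type*} (s : Finset ι) (u : ι → ℝ) {C : ℝ} (h : ∀ i, |u i| ≤ C) :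
    |∑ i ∈ s, u i| ≤ s.card * C :=
  calc |∑ i ∈ s, u i| ≤ ∑ i ∈ s, |u i| := Finset.abs_sum_le_sum_abs _ _
    _ ≤ ∑ i ∈ s, C := Finset.sum_le_sum fun i _ => h i
    _ = s.card * C := by rw [Finset.sum_const, nsmul_eq_mul]

/-- the number of neighbours inside the region, as a sum over the region. [folklore] -/
theorem card_nbrs_filter_eq_sum {R : Finset (Fin (d + 1) → ℤ)} (y : ↥R) :
    ((((nbrs y.1).filter fun z => z ∈ R).card : ℕ) : ℝ) = ∑ z : ↥R, if z.1 ∈ nbrs y.1 then (1 : ℝ) else 0 := by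
  rw [Finset.sum_boole]
  congr 1
  refine Finset.card_bij' (fun z hz => ⟨z, (Finset.mem_filter.1 hz).2⟩) (fun z _ => z.1) ?_ ?_ ?_ ?_
  · intro z hz
    exact Finset.mem_filter.2 ⟨Finset.mem_univ _, (Finset.mem_filter.1 hz).1⟩
  · intro z hz
    exact Finset.mem_filter.2 ⟨(Finset.mem_filter.1 hz).2, z.2⟩
  · intro z _
    rfl
  · intro z _
    rfl

/-- **THE ACTION OF `n²(−Δ^N_R) + m² + (a/n^{d+1})·1_{same block}` ON A FUNCTION**: symmetric-difference form of the
Neumann Laplacian plus the mass term plus `a/n^{d+1}` times the block sum.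
[cite: Balaban1983RegularityDecay, p. 572 (1.3)–(1.6), case A = 0, dictionary of `B4Lower18`] -/
theorem fineOpR_mulVec_apply (n : ℕ) (a m2 : ℝ) {R : Finset (Fin (d + 1) → ℤ)} (w : ↥R → ℝ) (y : ↥R) :
    (fineOpR n a m2 R *ᵥ w) y
      = (n : ℝ) ^ 2 * (∑ z : ↥R, if z.1 ∈ nbrs y.1 then (w y - w z) else 0) + m2 * w y
        + a * ((n : ℝ) ^ (d + 1))⁻¹ * ∑ z : ↥R, if blk n z.1 = blk n y.1 then w z else 0 := by
  have hself : y.1 ∉ nbrs y.1 := not_mem_nbrs_self y.1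
  simp only [Matrix.mulVec, dotProduct, fineOpR, regionOpR, Matrix.of_apply]
  have hlap : ∑ z : ↥R, neumannLapR R y.1 z.1 * w z
      = ∑ z : ↥R, if z.1 ∈ nbrs y.1 then (w y - w z) else 0 := by
    have e1 : ∀ z : ↥R, neumannLapR R y.1 z.1 * w z
        = (if z = y then ((((nbrs y.1).filter fun z => z ∈ R).card : ℕ) : ℝ) * w y else 0)
          + (if z.1 ∈ nbrs y.1 then -w z else 0) := by
      intro z
      by_cases hz : z = y
      · rw [hz, if_pos rfl, if_neg hself, add_zero]
        simp only [neumannLapR, ite_true]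
      · have hz' : z.1 ≠ y.1 := fun h => hz (Subtype.ext h)
        rw [if_neg hz, zero_add]
        simp only [neumannLapR, if_neg hz']
        split_ifs <;> ring
    rw [Finset.sum_congr rfl fun z _ => e1 z, Finset.sum_add_distrib, Finset.sum_ite_eq' Finset.univ y,
      if_pos (Finset.mem_univ _), card_nbrs_filter_eq_sum, Finset.sum_mul, ← Finset.sum_add_distrib]
    refine Finset.sum_congr rfl fun z _ => ?_
    split_ifs <;> ring
  have hdiag : ∑ z : ↥R, diagK m2 y.1 z.1 * w z = m2 * w y := by
    have e1 : ∀ z : ↥R, diagK m2 y.1 z.1 * w z = if z = y then m2 * w y else 0 := by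
      intro z
      by_cases hz : z = y
      · rw [hz, if_pos rfl]
        simp only [diagK, ite_true]
      · have hz' : z.1 ≠ y.1 := fun h => hz (Subtype.ext h)
        rw [if_neg hz]
        simp only [diagK, if_neg hz', zero_mul]
    rw [Finset.sum_congr rfl fun z _ => e1 z, Finset.sum_ite_eq' Finset.univ y, if_pos (Finset.mem_univ _)]
  have havg : ∑ z : ↥R, avgK (a * ((n : ℝ) ^ (d + 1))⁻¹) n y.1 z.1 * w z
      = a * ((n : ℝ) ^ (d + 1))⁻¹ * ∑ z : ↥R, if blk n z.1 = blk n y.1 then w z else 0 := by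
    rw [Finset.mul_sum]
    refine Finset.sum_congr rfl fun z _ => ?_
    simp only [avgK]
    split_ifs <;> simp
  have e : ∀ z : ↥R, ((n : ℝ) ^ 2 * neumannLapR R y.1 z.1
      + (diagK m2 y.1 z.1 + avgK (a * ((n : ℝ) ^ (d + 1))⁻¹) n y.1 z.1)) * w z
      = (n : ℝ) ^ 2 * (neumannLapR R y.1 z.1 * w z) + diagK m2 y.1 z.1 * w z
        + avgK (a * ((n : ℝ) ^ (d + 1))⁻¹) n y.1 z.1 * w z := fun z => by ring
  rw [Finset.sum_congr rfl fun z _ => e z, Finset.sum_add_distrib, Finset.sum_add_distrib, ← Finset.mul_sum, hlap,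
    hdiag, havg]

/-- `Σ_{z ∈ R} [z = p]·C = [p ∈ R]·C`. [folklore] -/
theorem sum_ite_val_eq {R : Finset (Fin (d + 1) → ℤ)} (p : Fin (d + 1) → ℤ) (C : ℝ) :
    ∑ z : ↥R, (if z.1 = p then C else 0) = if p ∈ R then C else 0 := by
  by_cases hp : p ∈ R
  · rw [if_pos hp]
    have e : ∀ z : ↥R, (if z.1 = p then C else 0) = if z = ⟨p, hp⟩ then C else 0 := by
      intro z
      have : z.1 = p ↔ z = ⟨p, hp⟩ := ⟨fun h => Subtype.ext h, fun h => by rw [h]⟩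
      simp only [this]
    rw [Finset.sum_congr rfl fun z _ => e z, Finset.sum_ite_eq' Finset.univ (⟨p, hp⟩ : ↥R),
      if_pos (Finset.mem_univ _)]
  · rw [if_neg hp]
    exact Finset.sum_eq_zero fun z _ => if_neg fun h => hp (by rw [← h]; exact z.2)

/-! ## §2 Fine points of a box: translations along a direction, layers, block columns, counting -/

/-- the fine points `Π_i [0, n·M₀_i)` of the box `Π_i [0, M₀_i)` at mesh `1/n`. [folklore] -/
abbrev Pt (n : ℕ) (M0 : Fin (d + 1) → ℕ) : Type := ↥(boxDom (fun i => n * M0 i))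

section Geometry

variable {n : ℕ} {M0 : Fin (d + 1) → ℕ}

/-- coordinates of `t·e_μ`. [folklore] -/
theorem smul_uvec_apply (μ : Fin (d + 1)) (t : ℤ) (j : Fin (d + 1)) :
    (t • uvec μ : Fin (d + 1) → ℤ) j = if j = μ then t else 0 := by
  by_cases hj : j = μ
  · subst hj
    simp
  · simp [hj]

/-- translating a fine point along `μ` keeps it in the box as long as the `μ`-coordinate stays in range. [folklore] -/
theorem add_smul_uvec_mem (μ : Fin (d + 1)) {y : Fin (d + 1) → ℤ} (hy : y ∈ boxDom (fun i => n * M0 i)) {t : ℤ}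
    (h0 : 0 ≤ y μ + t) (h1 : y μ + t < (n : ℤ) * M0 μ) : y + t • uvec μ ∈ boxDom (fun i => n * M0 i) := by
  rw [mem_boxDom] at hy ⊢
  intro j
  rw [Pi.add_apply, smul_uvec_apply]
  by_cases hj : j = μ
  · subst hj
    rw [if_pos rfl]
    exact ⟨h0, by push_cast; exact h1⟩
  · rw [if_neg hj, add_zero]
    exact hy j

/-- a fine point with prescribed `μ`-coordinate `t ∈ [0, nM₀_μ)` and all other coordinates `0`. [folklore] -/
theorem single_mem (μ : Fin (d + 1)) (hM0 : ∀ j, 1 ≤ M0 j) (hn : 1 ≤ n) {t : ℤ} (h0 : 0 ≤ t)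
    (h1 : t < (n : ℤ) * M0 μ) : (t • uvec μ : Fin (d + 1) → ℤ) ∈ boxDom (fun i => n * M0 i) := by
  rw [mem_boxDom]
  intro j
  rw [smul_uvec_apply]
  by_cases hj : j = μ
  · subst hj
    rw [if_pos rfl]
    exact ⟨h0, by push_cast; exact h1⟩
  · rw [if_neg hj]
    refine ⟨le_rfl, ?_⟩
    have : (1 : ℤ) ≤ (n : ℤ) * M0 j := by
      have h := Nat.mul_le_mul hn (hM0 j)
      rw [one_mul] at h
      exact_mod_cast h
    push_cast
    linarith

/-- the translate `y + t·e_μ` as a fine point of the box (junk value `y` itself when the translate leaves the box).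
[folklore] -/
def shift (μ : Fin (d + 1)) (t : ℤ) (y : Pt n M0) : Pt n M0 :=
  if h : y.1 + t • uvec μ ∈ boxDom (fun i => n * M0 i) then ⟨_, h⟩ else y

/-- the coordinates of a translate that stays in the box. [folklore] -/
theorem shift_val (μ : Fin (d + 1)) {t : ℤ} {y : Pt n M0} (h : y.1 + t • uvec μ ∈ boxDom (fun i => n * M0 i)) :
    (shift μ t y).1 = y.1 + t • uvec μ := by
  unfold shift
  rw [dif_pos h]

/-- the `μ`-coordinate of a translate along `μ`. [folklore] -/
theorem shift_val_mu (μ : Fin (d + 1)) {t : ℤ} {y : Pt n M0} (h : y.1 + t • uvec μ ∈ boxDom (fun i => n * M0 i)) :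
    (shift μ t y).1 μ = y.1 μ + t := by
  rw [shift_val μ h, Pi.add_apply, smul_uvec_apply, if_pos rfl]

/-- translation along `μ` fixes the other coordinates. [folklore] -/
theorem shift_val_ne (μ : Fin (d + 1)) {t : ℤ} {y : Pt n M0} (h : y.1 + t • uvec μ ∈ boxDom (fun i => n * M0 i))
    {j : Fin (d + 1)} (hj : j ≠ μ) : (shift μ t y).1 j = y.1 j := by
  rw [shift_val μ h, Pi.add_apply, smul_uvec_apply, if_neg hj, add_zero]

/-- translation by `0`. [folklore] -/
theorem shift_zero (μ : Fin (d + 1)) (y : Pt n M0) : shift μ 0 y = y := by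
  apply Subtype.ext
  have h : y.1 + (0 : ℤ) • uvec μ ∈ boxDom (fun i => n * M0 i) := by simp
  rw [shift_val μ h, zero_smul, add_zero]

/-- two successive translations inside the box compose. [folklore] -/
theorem shift_shift (μ : Fin (d + 1)) {s t : ℤ} {y : Pt n M0} (hs : y.1 + s • uvec μ ∈ boxDom (fun i => n * M0 i))
    (hst : y.1 + (s + t) • uvec μ ∈ boxDom (fun i => n * M0 i)) : shift μ t (shift μ s y) = shift μ (s + t) y := by
  apply Subtype.ext
  have h2 : (shift μ s y).1 + t • uvec μ ∈ boxDom (fun i => n * M0 i) := by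
    rw [shift_val μ hs, add_assoc, ← add_smul]
    exact hst
  rw [shift_val μ h2, shift_val μ hst, shift_val μ hs, add_assoc, add_smul]

/-- the forward neighbour of a translate. [folklore] -/
theorem shift_val_add_uvec (μ : Fin (d + 1)) {s : ℤ} {y : Pt n M0}
    (hs : y.1 + s • uvec μ ∈ boxDom (fun i => n * M0 i)) : (shift μ s y).1 + uvec μ = y.1 + (s + 1) • uvec μ := by
  rw [shift_val μ hs, add_smul, one_smul, add_assoc]

/-- translation is injective on points it keeps in the box. [folklore] -/
theorem shift_injOn (μ : Fin (d + 1)) (t : ℤ) {s : Finset (Pt n M0)}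
    (hs : ∀ y ∈ s, y.1 + t • uvec μ ∈ boxDom (fun i => n * M0 i)) :
    ∀ x ∈ s, ∀ y ∈ s, shift μ t x = shift μ t y → x = y := by
  intro x hx y hy h
  apply Subtype.ext
  have := congrArg Subtype.val h
  rw [shift_val μ (hs x hx), shift_val μ (hs y hy)] at this
  exact add_right_cancel this

/-- the layer `{y : y_μ = t}` of fine points of the box. [folklore] -/
def layer (n : ℕ) (M0 : Fin (d + 1) → ℕ) (μ : Fin (d + 1)) (t : ℤ) : Finset (Pt n M0) :=
  Finset.univ.filter fun y => y.1 μ = t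

/-- membership in a layer `{y_μ = t}`. [folklore] -/
theorem mem_layer {μ : Fin (d + 1)} {t : ℤ} {y : Pt n M0} : y ∈ layer n M0 μ t ↔ y.1 μ = t := by
  simp [layer]

/-- all layers have the same number of points. [folklore] -/
theorem card_layer_eq (μ : Fin (d + 1)) {s t : ℤ} (hs0 : 0 ≤ s) (hs1 : s < (n : ℤ) * M0 μ) (ht0 : 0 ≤ t)
    (ht1 : t < (n : ℤ) * M0 μ) : (layer n M0 μ s).card = (layer n M0 μ t).card := by
  have hS : ∀ y ∈ layer n M0 μ s, y.1 + (t - s) • uvec μ ∈ boxDom (fun i => n * M0 i) := fun y hy =>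
    add_smul_uvec_mem μ y.2 (by rw [mem_layer.1 hy]; linarith) (by rw [mem_layer.1 hy]; linarith)
  have hT : ∀ y ∈ layer n M0 μ t, y.1 + (s - t) • uvec μ ∈ boxDom (fun i => n * M0 i) := fun y hy =>
    add_smul_uvec_mem μ y.2 (by rw [mem_layer.1 hy]; linarith) (by rw [mem_layer.1 hy]; linarith)
  refine Finset.card_bij' (fun y _ => shift μ (t - s) y) (fun y _ => shift μ (s - t) y) ?_ ?_ ?_ ?_
  · intro y hy
    rw [mem_layer, shift_val_mu μ (hS y hy), mem_layer.1 hy]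
    ring
  · intro y hy
    rw [mem_layer, shift_val_mu μ (hT y hy), mem_layer.1 hy]
    ring
  · intro y hy
    have h0 : y.1 + (t - s + (s - t)) • uvec μ ∈ boxDom (fun i => n * M0 i) := by simp
    rw [shift_shift μ (hS y hy) h0, show t - s + (s - t) = 0 by ring, shift_zero]
  · intro y hy
    have h0 : y.1 + (s - t + (t - s)) • uvec μ ∈ boxDom (fun i => n * M0 i) := by simp
    rw [shift_shift μ (hT y hy) h0, show s - t + (t - s) = 0 by ring, shift_zero]

/-- a layer in range is nonempty. [folklore] -/
theorem layer_nonempty (μ : Fin (d + 1)) (hM0 : ∀ j, 1 ≤ M0 j) (hn : 1 ≤ n) {t : ℤ} (h0 : 0 ≤ t)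
    (h1 : t < (n : ℤ) * M0 μ) : (layer n M0 μ t).Nonempty :=
  ⟨⟨t • uvec μ, single_mem μ hM0 hn h0 h1⟩, by
    rw [mem_layer]
    show (t • uvec μ : Fin (d + 1) → ℤ) μ = t
    rw [smul_uvec_apply, if_pos rfl]⟩

/-- sums over consecutive layers correspond under the unit translation. [folklore] -/
theorem sum_layer_succ (μ : Fin (d + 1)) {t : ℤ} (ht0 : 0 ≤ t) (ht1 : t + 1 < (n : ℤ) * M0 μ) (φ : Pt n M0 → ℝ) :
    ∑ y ∈ layer n M0 μ (t + 1), φ y = ∑ x ∈ layer n M0 μ t, φ (shift μ 1 x) := by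
  have hS : ∀ y ∈ layer n M0 μ t, y.1 + (1 : ℤ) • uvec μ ∈ boxDom (fun i => n * M0 i) := fun y hy =>
    add_smul_uvec_mem μ y.2 (by rw [mem_layer.1 hy]; linarith) (by rw [mem_layer.1 hy]; linarith)
  have hT : ∀ y ∈ layer n M0 μ (t + 1), y.1 + (-1 : ℤ) • uvec μ ∈ boxDom (fun i => n * M0 i) := fun y hy =>
    add_smul_uvec_mem μ y.2 (by rw [mem_layer.1 hy]; linarith) (by rw [mem_layer.1 hy]; linarith)
  symm
  refine Finset.sum_nbij' (shift μ 1) (shift μ (-1)) ?_ ?_ ?_ ?_ ?_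
  · intro y hy
    rw [mem_layer, shift_val_mu μ (hS y hy), mem_layer.1 hy]
  · intro y hy
    rw [mem_layer, shift_val_mu μ (hT y hy), mem_layer.1 hy]
    ring
  · intro y hy
    have h0 : y.1 + (1 + -1 : ℤ) • uvec μ ∈ boxDom (fun i => n * M0 i) := by simp
    rw [shift_shift μ (hS y hy) h0, show (1 : ℤ) + -1 = 0 by ring, shift_zero]
  · intro y hy
    have h0 : y.1 + (-1 + 1 : ℤ) • uvec μ ∈ boxDom (fun i => n * M0 i) := by simp
    rw [shift_shift μ (hT y hy) h0, show (-1 : ℤ) + 1 = 0 by ring, shift_zero]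
  · intro y _
    rfl

/-- the `μ`-block coordinate `q = ⌊y_μ/n⌋` equals `m` iff `y_μ ∈ [mn, (m+1)n)`. [folklore] -/
theorem ediv_eq_iff (hn : 1 ≤ n) (c m : ℤ) : c / (n : ℤ) = m ↔ m * n ≤ c ∧ c < (m + 1) * n := by
  have hn' : (0 : ℤ) < n := by exact_mod_cast hn
  rw [le_antisymm_iff, ← Int.lt_add_one_iff, Int.ediv_lt_iff_lt_mul hn', Int.le_ediv_iff_mul_le hn', and_comm]

/-- the `μ`-coordinate of the unit block of a fine point is `⌊y_μ/n⌋`. [folklore] -/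
theorem blk_apply_mu (y : Fin (d + 1) → ℤ) (μ : Fin (d + 1)) : blk n y μ = y μ / (n : ℤ) := rfl

/-- a block column `{y : ⌊y_μ/n⌋ = m}` consists of `n` layers: it has `n` times the points of a layer. [folklore] -/
theorem card_blockCol (μ : Fin (d + 1)) (hn : 1 ≤ n) {m : ℤ} (hm0 : 0 ≤ m) (hm1 : m + 1 ≤ (M0 μ : ℤ)) :
    (Finset.univ.filter fun y : Pt n M0 => blk n y.1 μ = m).card = n * (layer n M0 μ 0).card := by
  have hn' : (0 : ℤ) < n := by exact_mod_cast hn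
  have hM : (0 : ℤ) < (n : ℤ) * M0 μ := by nlinarith
  have H : ∀ y ∈ (Finset.univ.filter fun y : Pt n M0 => blk n y.1 μ = m), y.1 μ ∈ Finset.Ico (m * n) ((m + 1) * n) := by
    intro y hy
    have h := (Finset.mem_filter.1 hy).2
    rw [blk_apply_mu, ediv_eq_iff hn] at h
    exact Finset.mem_Ico.2 h
  rw [Finset.card_eq_sum_card_fiberwise H]
  have hfib : ∀ b ∈ Finset.Ico (m * n) ((m + 1) * n),
      ((Finset.univ.filter fun y : Pt n M0 => blk n y.1 μ = m).filter fun y => y.1 μ = b).card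
        = (layer n M0 μ 0).card := by
    intro b hb
    obtain ⟨hb0, hb1⟩ := Finset.mem_Ico.1 hb
    have e : ((Finset.univ.filter fun y : Pt n M0 => blk n y.1 μ = m).filter fun y => y.1 μ = b)
        = layer n M0 μ b := by
      ext y
      simp only [Finset.mem_filter, Finset.mem_univ, true_and, layer]
      constructor
      · exact fun h => h.2
      · intro h
        refine ⟨?_, h⟩
        rw [blk_apply_mu, ediv_eq_iff hn, h]
        exact ⟨hb0, hb1⟩
    rw [e]
    exact card_layer_eq μ (by nlinarith) (by nlinarith) le_rfl hM
  rw [Finset.sum_congr rfl hfib, Finset.sum_const, Int.card_Ico, smul_eq_mul]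
  have : (m + 1) * (n : ℤ) - m * n = n := by ring
  rw [this, Int.toNat_natCast]

end Geometry

/-! ## §3 The energy bound: `a⟨1_Ω, G_k(Ω₀,0)1_Ω⟩ ≤ |Ω-points| − |B_in|/(2(1+a))` -/

section Energy

variable (n : ℕ) (a : ℝ) (M0 : Fin (d + 1) → ℕ) (μ : Fin (d + 1)) (m : ℕ)

/-- the source: the indicator `1_Ω` of the inner fine points `{y : ⌊y_μ/n⌋ < m}` (`Ω = {y_μ < m}` in unit-block units,
same transverse extent as `Ω₀`), as a function on the fine points of `Ω₀`. [folklore] -/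
def ind : Pt n M0 → ℝ := fun y => if blk n y.1 μ < (m : ℤ) then 1 else 0

/-- `u = G_k(Ω₀,0)1_Ω` (mass `0`): the solution of `(−Δ^{η,N}_{Ω₀} + aP_k)u = 1_Ω` on the fine points of `Ω₀`.
[cite: Balaban1983RegularityDecay, p. 572 (1.6), case A = 0] -/
def sol : Pt n M0 → ℝ := (fineOpR n a 0 (boxDom fun i => n * M0 i))⁻¹ *ᵥ ind n M0 μ m

variable {n a M0 μ m}

/-- `0 ≤ 1_Ω`. [folklore] -/
theorem ind_nonneg (y : Pt n M0) : 0 ≤ ind n M0 μ m y := by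
  unfold ind; split_ifs <;> norm_num

/-- `1_Ω ≤ 1`. [folklore] -/
theorem ind_le_one (y : Pt n M0) : ind n M0 μ m y ≤ 1 := by
  unfold ind; split_ifs <;> norm_num

/-- `|1_Ω| ≤ 1`. [folklore] -/
theorem abs_ind_le_one (y : Pt n M0) : |ind n M0 μ m y| ≤ 1 := by
  rw [abs_of_nonneg (ind_nonneg y)]; exact ind_le_one y

/-- the equation: `(−Δ + aP)u = 1_Ω`. [folklore] -/
theorem fineOpR_mulVec_sol (hn : 1 ≤ n) (ha : 0 < a) :
    fineOpR n a 0 (boxDom fun i => n * M0 i) *ᵥ sol n a M0 μ m = ind n M0 μ m := by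
  rw [sol, Matrix.mulVec_mulVec, fineOpR_mul_inv hn ha.le (by rw [add_zero]; exact lt_min two_pos ha)
    (boxDom_isBlockUnion hn M0), Matrix.one_mulVec]

/-- `⟨u, (−Δ+aP)u⟩ = ⟨1_Ω, u⟩`. [folklore] -/
theorem form_eq_pairing (hn : 1 ≤ n) (ha : 0 < a) :
    sol n a M0 μ m ⬝ᵥ (fineOpR n a 0 (boxDom fun i => n * M0 i) *ᵥ sol n a M0 μ m)
      = ∑ y, ind n M0 μ m y * sol n a M0 μ m y := by
  rw [fineOpR_mulVec_sol hn ha, dotProduct]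
  exact Finset.sum_congr rfl fun y _ => mul_comm _ _

/-- **THE BLOCK PAIRING BOUND** (AM–GM block by block): for a function `H(⌊y_μ/n⌋)` constant on blocks,
`⟨H, u⟩ ≤ ‖H‖²/(2a) + ½·a‖Q_k u‖²`. [folklore] -/
theorem block_pairing_le (hn : 1 ≤ n) (ha : 0 < a) (H : ℤ → ℝ) (u : Pt n M0 → ℝ) :
    ∑ y, H (blk n y.1 μ) * u y
      ≤ 1 / (2 * a) * ∑ y : Pt n M0, H (blk n y.1 μ) ^ 2
        + 1 / 2 * (a * ((n : ℝ) ^ (d + 1))⁻¹ * ∑ b : ↥((boxDom fun i => n * M0 i).image (blk n)),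
            (∑ x ∈ Finset.univ.filter (fun x => rblk n (boxDom fun i => n * M0 i) x = b), u x) ^ 2) := by
  have hR : IsBlockUnion n (boxDom fun i => n * M0 i) := boxDom_isBlockUnion hn M0
  have hnR : (0 : ℝ) < n := by exact_mod_cast hn
  have key : ∀ b : ↥((boxDom fun i => n * M0 i).image (blk n)),
      ∑ y ∈ Finset.univ.filter (fun x => rblk n (boxDom fun i => n * M0 i) x = b), H (blk n y.1 μ) * u y
        ≤ 1 / (2 * a) * ∑ y ∈ Finset.univ.filter (fun x => rblk n (boxDom fun i => n * M0 i) x = b),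
            H (blk n y.1 μ) ^ 2
          + 1 / 2 * (a * ((n : ℝ) ^ (d + 1))⁻¹
            * (∑ x ∈ Finset.univ.filter (fun x => rblk n (boxDom fun i => n * M0 i) x = b), u x) ^ 2) := by
    intro b
    set F := Finset.univ.filter (fun x => rblk n (boxDom fun i => n * M0 i) x = b) with hF
    have hcard : (F.card : ℝ) = (n : ℝ) ^ (d + 1) := by
      rw [hF, card_filter_rblk hn hR b]
      push_cast
      rfl
    have hconst : ∀ y ∈ F, H (blk n y.1 μ) = H (b.1 μ) := by
      intro y hy
      have h := (Finset.mem_filter.1 hy).2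
      rw [← h]
      rfl
    have e1 : ∑ y ∈ F, H (blk n y.1 μ) * u y = ∑ y ∈ F, H (b.1 μ) * u y :=
      Finset.sum_congr rfl fun y hy => by rw [hconst y hy]
    have e2 : ∑ y ∈ F, H (blk n y.1 μ) ^ 2 = ∑ y ∈ F, H (b.1 μ) ^ 2 :=
      Finset.sum_congr rfl fun y hy => by rw [hconst y hy]
    rw [e1, ← Finset.mul_sum, e2, Finset.sum_const, nsmul_eq_mul, hcard]
    have e : H (b.1 μ) ^ 2 / (2 * (a * ((n : ℝ) ^ (d + 1))⁻¹))
        = 1 / (2 * a) * ((n : ℝ) ^ (d + 1) * H (b.1 μ) ^ 2) := by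
      have ha' : a ≠ 0 := ha.ne'
      have hn' : (n : ℝ) ^ (d + 1) ≠ 0 := by positivity
      field_simp
    calc H (b.1 μ) * ∑ y ∈ F, u y
        ≤ H (b.1 μ) ^ 2 / (2 * (a * ((n : ℝ) ^ (d + 1))⁻¹))
            + a * ((n : ℝ) ^ (d + 1))⁻¹ * (∑ y ∈ F, u y) ^ 2 / 2 := am_gm (by positivity)
      _ = 1 / (2 * a) * ((n : ℝ) ^ (d + 1) * H (b.1 μ) ^ 2)
            + 1 / 2 * (a * ((n : ℝ) ^ (d + 1))⁻¹ * (∑ x ∈ F, u x) ^ 2) := by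
          rw [e]
          ring
  calc ∑ y, H (blk n y.1 μ) * u y
      = ∑ b : ↥((boxDom fun i => n * M0 i).image (blk n)),
          ∑ y ∈ Finset.univ.filter (fun x => rblk n (boxDom fun i => n * M0 i) x = b), H (blk n y.1 μ) * u y :=
        (Finset.sum_fiberwise (s := Finset.univ) (g := rblk n (boxDom fun i => n * M0 i))
          (f := fun y => H (blk n y.1 μ) * u y)).symm
    _ ≤ ∑ b : ↥((boxDom fun i => n * M0 i).image (blk n)),
          (1 / (2 * a) * ∑ y ∈ Finset.univ.filter (fun x => rblk n (boxDom fun i => n * M0 i) x = b),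
              H (blk n y.1 μ) ^ 2
            + 1 / 2 * (a * ((n : ℝ) ^ (d + 1))⁻¹
              * (∑ x ∈ Finset.univ.filter (fun x => rblk n (boxDom fun i => n * M0 i) x = b), u x) ^ 2)) :=
        Finset.sum_le_sum fun b _ => key b
    _ = 1 / (2 * a) * ∑ y : Pt n M0, H (blk n y.1 μ) ^ 2
        + 1 / 2 * (a * ((n : ℝ) ^ (d + 1))⁻¹ * ∑ b : ↥((boxDom fun i => n * M0 i).image (blk n)),
            (∑ x ∈ Finset.univ.filter (fun x => rblk n (boxDom fun i => n * M0 i) x = b), u x) ^ 2) := by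
        rw [Finset.sum_add_distrib, ← Finset.mul_sum, ← Finset.mul_sum, ← Finset.mul_sum,
          Finset.sum_fiberwise (s := Finset.univ) (g := rblk n (boxDom fun i => n * M0 i))
            (f := fun y => H (blk n y.1 μ) ^ 2)]

/-- the bond energy along `μ`: `Σ_x [x + e_μ ∈ Ω₀](u(x+e_μ) − u(x))²` is at most the full symmetric Dirichlet double
sum. [folklore] -/
theorem bond_sum_le (μ : Fin (d + 1)) (u : Pt n M0 → ℝ) :
    ∑ x : Pt n M0, (if x.1 + uvec μ ∈ boxDom (fun i => n * M0 i) then (u (shift μ 1 x) - u x) ^ 2 else 0)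
      ≤ ∑ x : Pt n M0, ∑ y : Pt n M0, if y.1 ∈ nbrs x.1 then (u x - u y) ^ 2 else 0 := by
  refine Finset.sum_le_sum fun x _ => ?_
  by_cases hx : x.1 + uvec μ ∈ boxDom (fun i => n * M0 i)
  · rw [if_pos hx]
    have hx' : x.1 + (1 : ℤ) • uvec μ ∈ boxDom (fun i => n * M0 i) := by rwa [one_smul]
    have hmem : (shift μ 1 x).1 ∈ nbrs x.1 := by
      rw [shift_val μ hx', one_smul]
      exact mem_nbrs.2 ⟨μ, Or.inl rfl⟩
    calc (u (shift μ 1 x) - u x) ^ 2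
        = (if (shift μ 1 x).1 ∈ nbrs x.1 then (u x - u (shift μ 1 x)) ^ 2 else 0) := by
          rw [if_pos hmem]
          ring
      _ ≤ ∑ y : Pt n M0, if y.1 ∈ nbrs x.1 then (u x - u y) ^ 2 else 0 := by
          have hnn : ∀ y ∈ (Finset.univ : Finset (Pt n M0)), 0 ≤ (if y.1 ∈ nbrs x.1 then (u x - u y) ^ 2 else 0) :=
            fun y _ => by split_ifs <;> positivity
          exact Finset.single_le_sum hnn (Finset.mem_univ _)
  · rw [if_neg hx]
    exact Finset.sum_nonneg fun y _ => by split_ifs <;> positivity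

/-- **THE FACE PAIRING BOUND** (telescoping along `μ` and AM–GM): with `B_in = {⌊y_μ/n⌋ = m−1}`, `B_out = {⌊y_μ/n⌋ = m}`,
`ε(Σ_{B_in} u − Σ_{B_out} u) ≤ ε²·#B_in + ½·(n²/2)·(symmetric Dirichlet double sum)`. [folklore] -/
theorem face_pairing_le (hn : 1 ≤ n) (hm1 : 1 ≤ m) (hm : m + 1 ≤ M0 μ) (ε : ℝ) (u : Pt n M0 → ℝ) :
    ε * (∑ y ∈ Finset.univ.filter (fun y : Pt n M0 => blk n y.1 μ = (m : ℤ) - 1), u y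
          - ∑ y ∈ Finset.univ.filter (fun y : Pt n M0 => blk n y.1 μ = (m : ℤ)), u y)
      ≤ ε ^ 2 * ((Finset.univ.filter fun y : Pt n M0 => blk n y.1 μ = (m : ℤ) - 1).card : ℝ)
        + 1 / 2 * ((n : ℝ) ^ 2 / 2
          * ∑ x : Pt n M0, ∑ y : Pt n M0, if y.1 ∈ nbrs x.1 then (u x - u y) ^ 2 else 0) := by
  set Bin := Finset.univ.filter (fun y : Pt n M0 => blk n y.1 μ = (m : ℤ) - 1) with hBin
  set Bout := Finset.univ.filter (fun y : Pt n M0 => blk n y.1 μ = (m : ℤ)) with hBout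
  have hn0 : (0 : ℤ) < n := by exact_mod_cast hn
  have hnR : (0 : ℝ) < n := by exact_mod_cast hn
  have hm0 : (0 : ℤ) ≤ (m : ℤ) - 1 := by
    have : (1 : ℤ) ≤ m := by exact_mod_cast hm1
    linarith
  have hmM : ((m : ℤ) + 1) * n ≤ (n : ℤ) * M0 μ := by
    have h : ((m + 1 : ℕ) : ℤ) ≤ M0 μ := by exact_mod_cast hm
    push_cast at h
    nlinarith
  have hBin_c : ∀ y ∈ Bin, ((m : ℤ) - 1) * n ≤ y.1 μ ∧ y.1 μ < (m : ℤ) * n := by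
    intro y hy
    have h := (Finset.mem_filter.1 hy).2
    rw [blk_apply_mu, ediv_eq_iff hn] at h
    simpa using h
  have hBout_c : ∀ y ∈ Bout, (m : ℤ) * n ≤ y.1 μ ∧ y.1 μ < ((m : ℤ) + 1) * n := by
    intro y hy
    have h := (Finset.mem_filter.1 hy).2
    rw [blk_apply_mu, ediv_eq_iff hn] at h
    exact h
  -- room along `μ`
  have hroom : ∀ y ∈ Bin, ∀ j : ℤ, 0 ≤ j → j ≤ n → y.1 + j • uvec μ ∈ boxDom (fun i => n * M0 i) := by
    intro y hy j hj0 hjn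
    obtain ⟨h1, h2⟩ := hBin_c y hy
    refine add_smul_uvec_mem μ y.2 ?_ ?_
    · have : (0 : ℤ) ≤ ((m : ℤ) - 1) * n := mul_nonneg hm0 hn0.le
      linarith
    · nlinarith
  have hroom' : ∀ y ∈ Bout, y.1 + (-(n : ℤ)) • uvec μ ∈ boxDom (fun i => n * M0 i) := by
    intro y hy
    obtain ⟨h1, h2⟩ := hBout_c y hy
    refine add_smul_uvec_mem μ y.2 ?_ ?_
    · have : (0 : ℤ) ≤ ((m : ℤ) - 1) * n := mul_nonneg hm0 hn0.le
      nlinarith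
    · nlinarith
  -- (a) `Σ_{B_out} u = Σ_{y ∈ B_in} u(y + n e_μ)`
  have hBout_sum : ∑ y ∈ Bout, u y = ∑ y ∈ Bin, u (shift μ (n : ℤ) y) := by
    symm
    refine Finset.sum_nbij' (shift μ (n : ℤ)) (shift μ (-(n : ℤ))) ?_ ?_ ?_ ?_ ?_
    · intro y hy
      have h := hroom y hy n hn0.le le_rfl
      have hq := (Finset.mem_filter.1 hy).2
      rw [blk_apply_mu] at hq
      refine Finset.mem_filter.2 ⟨Finset.mem_univ _, ?_⟩
      rw [blk_apply_mu, shift_val_mu μ h, show y.1 μ + (n : ℤ) = y.1 μ + 1 * (n : ℤ) by ring,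
        Int.add_mul_ediv_right _ _ hn0.ne', hq]
      ring
    · intro y hy
      have h := hroom' y hy
      have hq := (Finset.mem_filter.1 hy).2
      rw [blk_apply_mu] at hq
      refine Finset.mem_filter.2 ⟨Finset.mem_univ _, ?_⟩
      rw [blk_apply_mu, shift_val_mu μ h, show y.1 μ + -(n : ℤ) = y.1 μ + (-1) * (n : ℤ) by ring,
        Int.add_mul_ediv_right _ _ hn0.ne', hq]
      ring
    · intro y hy
      have h0 : y.1 + ((n : ℤ) + -(n : ℤ)) • uvec μ ∈ boxDom (fun i => n * M0 i) := by simp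
      rw [shift_shift μ (hroom y hy n hn0.le le_rfl) h0, show (n : ℤ) + -(n : ℤ) = 0 by ring, shift_zero]
    · intro y hy
      have h0 : y.1 + (-(n : ℤ) + (n : ℤ)) • uvec μ ∈ boxDom (fun i => n * M0 i) := by simp
      rw [shift_shift μ (hroom' y hy) h0, show -(n : ℤ) + (n : ℤ) = 0 by ring, shift_zero]
    · intro y _
      rfl
  -- (b) telescoping along the `μ`-column through `y ∈ B_in`
  have htel : ∀ y ∈ Bin, u y - u (shift μ (n : ℤ) y)
      = -∑ j ∈ Finset.range n, (u (shift μ ((j : ℤ) + 1) y) - u (shift μ (j : ℤ) y)) := by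
    intro y _
    have h := Finset.sum_range_sub (fun j : ℕ => u (shift μ (j : ℤ) y)) n
    simp only [Nat.cast_succ, Nat.cast_zero] at h
    rw [h, shift_zero]
    ring
  -- (c) each increment is a bond of `Ω₀`, and for fixed `j` the bonds are distinct
  set G : Pt n M0 → ℝ := fun x =>
    if x.1 + uvec μ ∈ boxDom (fun i => n * M0 i) then (u (shift μ 1 x) - u x) ^ 2 else 0 with hG
  have hG0 : ∀ x, 0 ≤ G x := by
    intro x
    simp only [hG]
    split_ifs <;> positivity
  have hstep : ∀ y ∈ Bin, ∀ j ∈ Finset.range n,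
      (u (shift μ ((j : ℤ) + 1) y) - u (shift μ (j : ℤ) y)) ^ 2 = G (shift μ (j : ℤ) y) := by
    intro y hy j hj
    have hj' : (j : ℤ) < n := by exact_mod_cast Finset.mem_range.1 hj
    have h1 := hroom y hy j (by positivity) hj'.le
    have h2 := hroom y hy ((j : ℤ) + 1) (by positivity) (by linarith)
    have hx : (shift μ (j : ℤ) y).1 + uvec μ ∈ boxDom (fun i => n * M0 i) := by
      rw [shift_val_add_uvec μ h1]
      exact h2
    simp only [hG]
    rw [if_pos hx, shift_shift μ h1 h2]
  have hsumG : ∀ j ∈ Finset.range n, ∑ y ∈ Bin, G (shift μ (j : ℤ) y) ≤ ∑ x, G x := by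
    intro j hj
    have hj' : (j : ℤ) < n := by exact_mod_cast Finset.mem_range.1 hj
    have hinj := shift_injOn μ (j : ℤ) (s := Bin) fun y hy => hroom y hy j (by positivity) hj'.le
    rw [← Finset.sum_image hinj]
    exact Finset.sum_le_sum_of_subset_of_nonneg (Finset.subset_univ _) fun x _ _ => hG0 x
  have hGD := bond_sum_le μ u
  -- (d) AM–GM termwise with weight `t = n/2`
  have hterm : ∀ q : ℝ, -ε * q ≤ ε ^ 2 / n + (n : ℝ) / 4 * q ^ 2 := by
    intro q
    have h := am_gm (p := -ε) (q := q) (t := (n : ℝ) / 2) (by positivity)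
    have e : (-ε) ^ 2 / (2 * ((n : ℝ) / 2)) + (n : ℝ) / 2 * q ^ 2 / 2 = ε ^ 2 / n + (n : ℝ) / 4 * q ^ 2 := by
      field_simp
      ring
    linarith
  have hcol : ∀ y ∈ Bin, ε * (u y - u (shift μ (n : ℤ) y))
      ≤ ε ^ 2 + (n : ℝ) / 4 * ∑ j ∈ Finset.range n, G (shift μ (j : ℤ) y) := by
    intro y hy
    rw [htel y hy, mul_neg, ← neg_mul, Finset.mul_sum]
    calc ∑ j ∈ Finset.range n, -ε * (u (shift μ ((j : ℤ) + 1) y) - u (shift μ (j : ℤ) y))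
        ≤ ∑ j ∈ Finset.range n, (ε ^ 2 / n + (n : ℝ) / 4 * (u (shift μ ((j : ℤ) + 1) y) - u (shift μ (j : ℤ) y)) ^ 2) :=
          Finset.sum_le_sum fun j _ => hterm _
      _ = ε ^ 2 + (n : ℝ) / 4 * ∑ j ∈ Finset.range n, G (shift μ (j : ℤ) y) := by
          have e3 : ∑ j ∈ Finset.range n, (n : ℝ) / 4 * (u (shift μ ((j : ℤ) + 1) y) - u (shift μ (j : ℤ) y)) ^ 2
              = ∑ j ∈ Finset.range n, (n : ℝ) / 4 * G (shift μ (j : ℤ) y) :=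
            Finset.sum_congr rfl fun j hj => by rw [hstep y hy j hj]
          rw [Finset.sum_add_distrib, Finset.sum_const, Finset.card_range, nsmul_eq_mul, Finset.mul_sum, e3]
          congr 1
          field_simp
  -- (e) assemble
  calc ε * (∑ y ∈ Bin, u y - ∑ y ∈ Bout, u y)
      = ∑ y ∈ Bin, ε * (u y - u (shift μ (n : ℤ) y)) := by
        rw [hBout_sum, ← Finset.sum_sub_distrib, Finset.mul_sum]
    _ ≤ ∑ y ∈ Bin, (ε ^ 2 + (n : ℝ) / 4 * ∑ j ∈ Finset.range n, G (shift μ (j : ℤ) y)) :=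
        Finset.sum_le_sum hcol
    _ = ε ^ 2 * (Bin.card : ℝ) + (n : ℝ) / 4 * ∑ j ∈ Finset.range n, ∑ y ∈ Bin, G (shift μ (j : ℤ) y) := by
        rw [Finset.sum_add_distrib, Finset.sum_const, nsmul_eq_mul, ← Finset.mul_sum, Finset.sum_comm]
        ring
    _ ≤ ε ^ 2 * (Bin.card : ℝ) + (n : ℝ) / 4 * ∑ j ∈ Finset.range n, ∑ x : Pt n M0, G x := by
        have := Finset.sum_le_sum hsumG
        have h4 : (0 : ℝ) ≤ (n : ℝ) / 4 := by positivity
        nlinarith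
    _ = ε ^ 2 * (Bin.card : ℝ) + (n : ℝ) ^ 2 / 4 * ∑ x : Pt n M0, G x := by
        rw [Finset.sum_const, Finset.card_range, nsmul_eq_mul]
        ring
    _ ≤ ε ^ 2 * (Bin.card : ℝ) + 1 / 2 * ((n : ℝ) ^ 2 / 2
          * ∑ x : Pt n M0, ∑ y : Pt n M0, if y.1 ∈ nbrs x.1 then (u x - u y) ^ 2 else 0) := by
        have h4 : (0 : ℝ) ≤ (n : ℝ) ^ 2 / 4 := by positivity
        nlinarith

/-- **THE ENERGY BOUND.** With `Ω = {⌊y_μ/n⌋ < m} ⊂ Ω₀`, `u = G_k(Ω₀,0)1_Ω`, `B_in = {⌊y_μ/n⌋ = m − 1}` the last block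
layer of `Ω` before the face `{y_μ = mn}`:  `a·⟨1_Ω, u⟩ ≤ #Ω − #B_in/(2(1+a))`.  (Test the variational
characterisation `⟨1_Ω,u⟩ = sup_w 2⟨1_Ω,w⟩ − ⟨w,(−Δ+aP)w⟩` against nothing: split `1_Ω = h + r` with `h` block-constant,
`h = 1_Ω ∓ ε` on `B_in`/`B_out`, `r = ±ε·1_{B_in/B_out}`; the block part costs `‖h‖²/a`, the face part is paid by the
Dirichlet form across the face.) [folklore] -/
theorem energy_bound (hn : 1 ≤ n) (ha : 0 < a) (hm1 : 1 ≤ m) (hm : m + 1 ≤ M0 μ) :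
    a * ∑ y, ind n M0 μ m y * sol n a M0 μ m y
      ≤ ((Finset.univ.filter fun y : Pt n M0 => blk n y.1 μ < (m : ℤ)).card : ℝ)
        - 1 / (2 * (1 + a)) * ((Finset.univ.filter fun y : Pt n M0 => blk n y.1 μ = (m : ℤ) - 1).card : ℝ) := by
  set u := sol n a M0 μ m with hu
  set ε : ℝ := 1 / (2 * (1 + a)) with hε
  have hε0 : 0 < ε := by positivity
  have hR : IsBlockUnion n (boxDom fun i => n * M0 i) := boxDom_isBlockUnion hn M0
  -- the decomposition `1_Ω = h + r`
  set H : ℤ → ℝ := fun q => (if q < (m : ℤ) then 1 else 0) - (if q = (m : ℤ) - 1 then ε else 0)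
    + (if q = (m : ℤ) then ε else 0) with hH
  have hdec : ∀ y : Pt n M0, ind n M0 μ m y = H (blk n y.1 μ)
      + (ε * (if blk n y.1 μ = (m : ℤ) - 1 then 1 else 0) - ε * (if blk n y.1 μ = (m : ℤ) then 1 else 0)) := by
    intro y
    have eH : H (blk n y.1 μ) = (if blk n y.1 μ < (m : ℤ) then 1 else 0)
        - (if blk n y.1 μ = (m : ℤ) - 1 then ε else 0) + (if blk n y.1 μ = (m : ℤ) then ε else 0) := rfl
    rw [eH]
    simp only [ind]
    split_ifs <;> ring
  -- `Σ H² = #Ω − (2ε − ε²)·#B_in + ε²·#B_out`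
  have hH2 : ∀ y : Pt n M0, H (blk n y.1 μ) ^ 2 = (if blk n y.1 μ < (m : ℤ) then 1 else 0)
      - (2 * ε - ε ^ 2) * (if blk n y.1 μ = (m : ℤ) - 1 then 1 else 0)
      + ε ^ 2 * (if blk n y.1 μ = (m : ℤ) then 1 else 0) := by
    intro y
    have hm' : (m : ℤ) - 1 < m := by linarith
    have eH : H (blk n y.1 μ) = (if blk n y.1 μ < (m : ℤ) then 1 else 0)
        - (if blk n y.1 μ = (m : ℤ) - 1 then ε else 0) + (if blk n y.1 μ = (m : ℤ) then ε else 0) := rfl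
    rw [eH]
    by_cases h1 : blk n y.1 μ = (m : ℤ) - 1
    · have hlt : blk n y.1 μ < (m : ℤ) := by rw [h1]; exact hm'
      have hne : blk n y.1 μ ≠ (m : ℤ) := by rw [h1]; exact hm'.ne
      rw [if_pos hlt, if_pos h1, if_neg hne, if_pos h1, if_neg hne]
      ring
    · by_cases h2 : blk n y.1 μ = (m : ℤ)
      · have hnl : ¬ blk n y.1 μ < (m : ℤ) := by rw [h2]; exact lt_irrefl _
        rw [if_neg hnl, if_neg h1, if_pos h2, if_neg h1, if_pos h2]
        ring
      · rw [if_neg h1, if_neg h2, if_neg h1, if_neg h2]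
        split_ifs <;> ring
  have h2a : (2 * (1 + a)) ≠ 0 := by positivity
  have hεa : ε * (2 * (1 + a)) = 1 := by
    rw [hε]
    field_simp
  have he2 : 2 * a * ε ^ 2 = ε - 2 * ε ^ 2 := by
    have : 2 * a * ε ^ 2 = ε * (ε * (2 * (1 + a))) - 2 * ε ^ 2 := by ring
    rw [this, hεa]
    ring
  have hm0 : (0 : ℤ) ≤ (m : ℤ) - 1 := by
    have : (1 : ℤ) ≤ m := by exact_mod_cast hm1
    linarith
  have hmM : (m : ℤ) - 1 + 1 ≤ (M0 μ : ℤ) := by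
    have h : ((m + 1 : ℕ) : ℤ) ≤ M0 μ := by exact_mod_cast hm
    push_cast at h
    linarith
  -- `#B_out = #B_in`
  have hcnt : ((Finset.univ.filter fun y : Pt n M0 => blk n y.1 μ = (m : ℤ)).card : ℝ)
      = ((Finset.univ.filter fun y : Pt n M0 => blk n y.1 μ = (m : ℤ) - 1).card : ℝ) := by
    rw [card_blockCol μ hn (m := (m : ℤ)) (by positivity) (by exact_mod_cast hm),
      card_blockCol μ hn (m := (m : ℤ) - 1) hm0 hmM]
  have hsumH2 : ∑ y : Pt n M0, H (blk n y.1 μ) ^ 2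
      = ((Finset.univ.filter fun y : Pt n M0 => blk n y.1 μ < (m : ℤ)).card : ℝ)
        - (2 * ε - ε ^ 2) * ((Finset.univ.filter fun y : Pt n M0 => blk n y.1 μ = (m : ℤ) - 1).card : ℝ)
        + ε ^ 2 * ((Finset.univ.filter fun y : Pt n M0 => blk n y.1 μ = (m : ℤ)).card : ℝ) := by
    rw [Finset.sum_congr rfl fun y _ => hH2 y, Finset.sum_add_distrib, Finset.sum_sub_distrib,
      ← Finset.mul_sum, ← Finset.mul_sum, Finset.sum_boole, Finset.sum_boole, Finset.sum_boole]
  -- `I = Σ H·u + ε(Σ_{B_in} u − Σ_{B_out} u)`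
  have hdecS : ∑ y, ind n M0 μ m y * u y = ∑ y, H (blk n y.1 μ) * u y
      + ε * (∑ y ∈ Finset.univ.filter (fun y : Pt n M0 => blk n y.1 μ = (m : ℤ) - 1), u y
          - ∑ y ∈ Finset.univ.filter (fun y : Pt n M0 => blk n y.1 μ = (m : ℤ)), u y) := by
    rw [Finset.sum_filter, Finset.sum_filter, ← Finset.sum_sub_distrib, Finset.mul_sum, ← Finset.sum_add_distrib]
    refine Finset.sum_congr rfl fun y _ => ?_
    rw [hdec y]
    split_ifs <;> ring
  -- the two pairing bounds and the quadratic form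
  have hE1 := block_pairing_le (M0 := M0) (μ := μ) hn ha H u
  have hE2 := face_pairing_le (M0 := M0) (μ := μ) hn hm1 hm ε u
  have hpair := form_eq_pairing (M0 := M0) (μ := μ) (m := m) hn ha
  rw [← hu] at hpair
  have hform := fineOpR_form hn hR a 0 u
  rw [hpair, zero_mul, add_zero] at hform
  -- `I ≤ (1/2a)ΣH² + ε²#B_in + I/2`
  have h1 : ∑ y, ind n M0 μ m y * u y
      ≤ 1 / (2 * a) * ∑ y : Pt n M0, H (blk n y.1 μ) ^ 2
        + ε ^ 2 * ((Finset.univ.filter fun y : Pt n M0 => blk n y.1 μ = (m : ℤ) - 1).card : ℝ)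
        + 1 / 2 * ∑ y, ind n M0 μ m y * u y := by
    linarith [hE1, hE2, hdecS, hform]
  have h3 : a * ∑ y, ind n M0 μ m y * u y
      ≤ ∑ y : Pt n M0, H (blk n y.1 μ) ^ 2
        + 2 * a * ε ^ 2 * ((Finset.univ.filter fun y : Pt n M0 => blk n y.1 μ = (m : ℤ) - 1).card : ℝ) := by
    have h2 : (1 / 2) * ∑ y, ind n M0 μ m y * u y
        ≤ 1 / (2 * a) * ∑ y : Pt n M0, H (blk n y.1 μ) ^ 2
          + ε ^ 2 * ((Finset.univ.filter fun y : Pt n M0 => blk n y.1 μ = (m : ℤ) - 1).card : ℝ) := by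
      linarith [h1]
    have h := mul_le_mul_of_nonneg_left h2 (le_of_lt (by positivity : (0 : ℝ) < 2 * a))
    have e1 : 2 * a * ((1 / 2) * ∑ y, ind n M0 μ m y * u y) = a * ∑ y, ind n M0 μ m y * u y := by ring
    have e2 : 2 * a * (1 / (2 * a) * ∑ y : Pt n M0, H (blk n y.1 μ) ^ 2
        + ε ^ 2 * ((Finset.univ.filter fun y : Pt n M0 => blk n y.1 μ = (m : ℤ) - 1).card : ℝ))
        = ∑ y : Pt n M0, H (blk n y.1 μ) ^ 2
          + 2 * a * ε ^ 2 * ((Finset.univ.filter fun y : Pt n M0 => blk n y.1 μ = (m : ℤ) - 1).card : ℝ) := by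
      have h2a' : 2 * a * (1 / (2 * a)) = 1 := by
        have ha' : a ≠ 0 := ha.ne'
        field_simp
      calc 2 * a * (1 / (2 * a) * ∑ y : Pt n M0, H (blk n y.1 μ) ^ 2
            + ε ^ 2 * ((Finset.univ.filter fun y : Pt n M0 => blk n y.1 μ = (m : ℤ) - 1).card : ℝ))
          = (2 * a * (1 / (2 * a))) * ∑ y : Pt n M0, H (blk n y.1 μ) ^ 2
            + 2 * a * ε ^ 2 * ((Finset.univ.filter fun y : Pt n M0 => blk n y.1 μ = (m : ℤ) - 1).card : ℝ) := by
            ring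
        _ = _ := by rw [h2a', one_mul]
    rw [e1, e2] at h
    exact h
  have he3 : 2 * a * ε ^ 2 * ((Finset.univ.filter fun y : Pt n M0 => blk n y.1 μ = (m : ℤ) - 1).card : ℝ)
      = (ε - 2 * ε ^ 2) * ((Finset.univ.filter fun y : Pt n M0 => blk n y.1 μ = (m : ℤ) - 1).card : ℝ) := by
    rw [he2]
  have hcnt2 : ε ^ 2 * ((Finset.univ.filter fun y : Pt n M0 => blk n y.1 μ = (m : ℤ)).card : ℝ)
      = ε ^ 2 * ((Finset.univ.filter fun y : Pt n M0 => blk n y.1 μ = (m : ℤ) - 1).card : ℝ) := by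
    rw [hcnt]
  linarith [h3, he3, hcnt2, hsumH2]

end Energy

/-! ## §4 The sum rule one layer inside the face of `Ω`, and a point of large inward normal derivative -/

section Layer

variable (n : ℕ) (M0 : Fin (d + 1) → ℕ) (μ : Fin (d + 1))

/-- the test function `v = 1_{y_μ ≤ F − 2}`: the indicator of `Ω` minus its face layer `{y_μ = F − 1}` (`F = nm`).
[folklore] -/
def vfun (F : ℤ) : Pt n M0 → ℝ := fun y => if y.1 μ ≤ F - 2 then 1 else 0

/-- the indicator of the face layer `{y_μ = F − 1}` of `Ω`. [folklore] -/
def lay (F : ℤ) : Pt n M0 → ℝ := fun y => if y.1 μ = F - 1 then 1 else 0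

variable {n M0 μ}

/-- the layer indicator is nonnegative. [folklore] -/
theorem lay_nonneg (F : ℤ) (y : Pt n M0) : 0 ≤ lay n M0 μ F y := by
  unfold lay; split_ifs <;> norm_num

/-- `1_Ω` in fine coordinates: `⌊y_μ/n⌋ < m ↔ y_μ < nm`. [folklore] -/
theorem ind_eq (hn : 1 ≤ n) (m : ℕ) (y : Pt n M0) :
    ind n M0 μ m y = if y.1 μ < (n : ℤ) * m then 1 else 0 := by
  have hn' : (0 : ℤ) < n := by exact_mod_cast hn
  have h : blk n y.1 μ < (m : ℤ) ↔ y.1 μ < (n : ℤ) * m := by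
    rw [blk_apply_mu, Int.ediv_lt_iff_lt_mul hn', mul_comm]
  simp only [ind, h]

/-- `v = 1_Ω − 1_{face layer}`. [folklore] -/
theorem vfun_eq (hn : 1 ≤ n) (m : ℕ) (y : Pt n M0) :
    vfun n M0 μ ((n : ℤ) * m) y = ind n M0 μ m y - lay n M0 μ ((n : ℤ) * m) y := by
  rw [ind_eq hn]
  generalize (n : ℤ) * (m : ℤ) = F
  simp only [vfun, lay]
  split_ifs <;> first | (exfalso; omega) | norm_num

/-- **`(−Δ^N_{Ω₀}) v` IS SUPPORTED ON THE TWO LAYERS NEXT TO THE CUT**: for `v = 1_{y_μ ≤ F−2}`,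
`Σ_{z ∼ y}(v(y) − v(z)) = [y_μ = F − 2] − [y_μ = F − 1]`. [folklore] -/
theorem lap_vfun {F : ℤ} (hF2 : 2 ≤ F) (hF : F ≤ (n : ℤ) * M0 μ) (y : Pt n M0) :
    ∑ z : Pt n M0, (if z.1 ∈ nbrs y.1 then (vfun n M0 μ F y - vfun n M0 μ F z) else 0)
      = (if y.1 μ = F - 2 then (1 : ℝ) else 0) - (if y.1 μ = F - 1 then (1 : ℝ) else 0) := by
  have hne : y.1 + uvec μ ≠ y.1 - uvec μ := by
    intro h
    have := congr_fun h μ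
    simp only [Pi.add_apply, Pi.sub_apply, uvec_apply_same] at this
    omega
  have hpt : ∀ z : Pt n M0, (if z.1 ∈ nbrs y.1 then (vfun n M0 μ F y - vfun n M0 μ F z) else 0)
      = (if z.1 = y.1 + uvec μ then (if y.1 μ = F - 2 then (1 : ℝ) else 0) else 0)
        - (if z.1 = y.1 - uvec μ then (if y.1 μ = F - 1 then (1 : ℝ) else 0) else 0) := by
    intro z
    by_cases hz : z.1 ∈ nbrs y.1
    · rw [if_pos hz]
      obtain ⟨i, hi | hi⟩ := mem_nbrs.1 hz
      · by_cases hiμ : i = μ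
        · subst hiμ
          have hz1 : z.1 = y.1 + uvec i := hi
          have hz2 : z.1 ≠ y.1 - uvec i := by rw [hz1]; exact hne
          rw [if_pos hz1, if_neg hz2, sub_zero]
          have hzc : z.1 i = y.1 i + 1 := by rw [hz1, Pi.add_apply, uvec_apply_same]
          simp only [vfun, hzc]
          split_ifs <;> first | (exfalso; omega) | norm_num
        · have hμi : μ ≠ i := fun h => hiμ h.symm
          have hzμ : z.1 μ = y.1 μ := by rw [hi, Pi.add_apply, Pi.single_eq_of_ne hμi, add_zero]
          have hz1 : z.1 ≠ y.1 + uvec μ := by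
            intro h
            have := congr_fun h μ
            rw [hzμ, Pi.add_apply, uvec_apply_same] at this
            omega
          have hz2 : z.1 ≠ y.1 - uvec μ := by
            intro h
            have := congr_fun h μ
            rw [hzμ, Pi.sub_apply, uvec_apply_same] at this
            omega
          rw [if_neg hz1, if_neg hz2, sub_zero]
          simp only [vfun, hzμ, sub_self]
      · by_cases hiμ : i = μ
        · subst hiμ
          have hz2 : z.1 = y.1 - uvec i := hi
          have hz1 : z.1 ≠ y.1 + uvec i := by rw [hz2]; exact fun h => hne h.symm
          rw [if_neg hz1, if_pos hz2, zero_sub]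
          have hzc : z.1 i = y.1 i - 1 := by rw [hz2, Pi.sub_apply, uvec_apply_same]
          simp only [vfun, hzc]
          split_ifs <;> first | (exfalso; omega) | norm_num
        · have hμi : μ ≠ i := fun h => hiμ h.symm
          have hzμ : z.1 μ = y.1 μ := by rw [hi, Pi.sub_apply, Pi.single_eq_of_ne hμi, sub_zero]
          have hz1 : z.1 ≠ y.1 + uvec μ := by
            intro h
            have := congr_fun h μ
            rw [hzμ, Pi.add_apply, uvec_apply_same] at this
            omega
          have hz2 : z.1 ≠ y.1 - uvec μ := by
            intro h
            have := congr_fun h μ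
            rw [hzμ, Pi.sub_apply, uvec_apply_same] at this
            omega
          rw [if_neg hz1, if_neg hz2, sub_zero]
          simp only [vfun, hzμ, sub_self]
    · rw [if_neg hz]
      have hz1 : z.1 ≠ y.1 + uvec μ := fun h => hz (mem_nbrs.2 ⟨μ, Or.inl h⟩)
      have hz2 : z.1 ≠ y.1 - uvec μ := fun h => hz (mem_nbrs.2 ⟨μ, Or.inr h⟩)
      rw [if_neg hz1, if_neg hz2, sub_zero]
  rw [Finset.sum_congr rfl fun z _ => hpt z, Finset.sum_sub_distrib, sum_ite_val_eq, sum_ite_val_eq]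
  congr 1
  · by_cases h2 : y.1 μ = F - 2
    · have hmem : y.1 + uvec μ ∈ boxDom (fun i => n * M0 i) := by
        have := add_smul_uvec_mem μ y.2 (t := 1) (by rw [h2]; linarith) (by rw [h2]; linarith)
        rwa [one_smul] at this
      rw [if_pos hmem]
    · rw [if_neg h2, ite_self]
  · by_cases h1 : y.1 μ = F - 1
    · have hmem : y.1 - uvec μ ∈ boxDom (fun i => n * M0 i) := by
        have := add_smul_uvec_mem μ y.2 (t := -1) (by rw [h1]; linarith) (by rw [h1]; linarith)
        rwa [neg_one_smul, ← sub_eq_add_neg] at this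
      rw [if_pos hmem]
    · rw [if_neg h1, ite_self]

/-- the layer indicator summed over a block and against `u`, `|Σ_y u(y)·Σ_{z ∈ block(y)}[z_μ = F−1]|`, is at most
`C·n^{d+1}·#layer` when `|u| ≤ C`. [folklore] -/
theorem lay_block_sum_le (hn : 1 ≤ n) (F : ℤ) (u : Pt n M0 → ℝ) {C : ℝ} (hC : ∀ y, |u y| ≤ C) :
    |∑ y, u y * ∑ z : Pt n M0, (if blk n z.1 = blk n y.1 then lay n M0 μ F z else 0)|
      ≤ C * ((n : ℝ) ^ (d + 1) * ((layer n M0 μ (F - 1)).card : ℝ)) := by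
  set W : Pt n M0 → ℝ := fun y => ∑ z : Pt n M0, (if blk n z.1 = blk n y.1 then lay n M0 μ F z else 0)
    with hW
  have hW0 : ∀ y, 0 ≤ W y := fun y => Finset.sum_nonneg fun z _ => by
    split_ifs
    · exact lay_nonneg F z
    · exact le_rfl
  have hblk : ∀ z : Pt n M0, ∑ y : Pt n M0, (if blk n z.1 = blk n y.1 then lay n M0 μ F z else 0)
      = lay n M0 μ F z * (n : ℝ) ^ (d + 1) := by
    intro z
    have e : ∀ y : Pt n M0, (if blk n z.1 = blk n y.1 then lay n M0 μ F z else 0)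
        = if blk n y.1 = blk n z.1 then lay n M0 μ F z else 0 := by
      intro y
      by_cases h : blk n z.1 = blk n y.1
      · rw [if_pos h, if_pos h.symm]
      · rw [if_neg h, if_neg fun h' => h h'.symm]
    rw [Finset.sum_congr rfl fun y _ => e y, ← Finset.sum_filter, Finset.sum_const, nsmul_eq_mul,
      card_filter_blk hn M0 ⟨blk n z.1, blk_mem_boxDom hn z.2⟩]
    push_cast
    ring
  have hWsum : ∑ y, W y = (n : ℝ) ^ (d + 1) * ((layer n M0 μ (F - 1)).card : ℝ) := by
    simp only [hW]
    rw [Finset.sum_comm, Finset.sum_congr rfl fun z _ => hblk z, ← Finset.sum_mul]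
    simp only [lay]
    rw [Finset.sum_boole, mul_comm]
    rfl
  calc |∑ y, u y * W y| ≤ ∑ y, |u y * W y| := Finset.abs_sum_le_sum_abs _ _
    _ ≤ ∑ y, C * W y := Finset.sum_le_sum fun y _ => by
        rw [abs_mul, abs_of_nonneg (hW0 y)]
        exact mul_le_mul_of_nonneg_right (hC y) (hW0 y)
    _ = C * ((n : ℝ) ^ (d + 1) * ((layer n M0 μ (F - 1)).card : ℝ)) := by rw [← Finset.mul_sum, hWsum]

variable (a : ℝ) (m : ℕ)

/-- **THE SUM RULE ONE LAYER INSIDE THE FACE.** Pair the equation `(−Δ^{η,N}_{Ω₀} + aP_k)u = 1_Ω` with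
`v = 1_{y_μ ≤ F−2}` (`F = nm`; symmetry of the operator):
`n²·Σ_{y_μ = F−2}(u(y) − u(y + e_μ)) + a⟨1_Ω,u⟩ − (a/n^{d+1})·Σ_y u(y)·Σ_{z ∈ block(y)}[z_μ = F−1] = #Ω − #layer`.
(Green's identity for the operator (1.6) of the print at `A = 0`.) [folklore] -/
theorem layer_identity (hn : 2 ≤ n) (ha : 0 < a) (hm1 : 1 ≤ m) (hm : m + 1 ≤ M0 μ) :
    (n : ℝ) ^ 2 * ∑ x ∈ layer n M0 μ ((n : ℤ) * m - 2), (sol n a M0 μ m x - sol n a M0 μ m (shift μ 1 x))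
      + a * ∑ y, ind n M0 μ m y * sol n a M0 μ m y
      - a * ((n : ℝ) ^ (d + 1))⁻¹ * ∑ y, sol n a M0 μ m y
          * ∑ z : Pt n M0, (if blk n z.1 = blk n y.1 then lay n M0 μ ((n : ℤ) * m) z else 0)
      = ((Finset.univ.filter fun y : Pt n M0 => blk n y.1 μ < (m : ℤ)).card : ℝ)
        - ((layer n M0 μ ((n : ℤ) * m - 1)).card : ℝ) := by
  have hn1 : 1 ≤ n := le_trans (by norm_num) hn
  have hn0 : (0 : ℤ) < n := by exact_mod_cast hn1
  have hnR : (0 : ℝ) < n := by exact_mod_cast hn1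
  have hAu := fineOpR_mulVec_sol (M0 := M0) (μ := μ) (m := m) hn1 ha
  set u := sol n a M0 μ m with hu
  set F : ℤ := (n : ℤ) * m with hFdef
  have hF2 : 2 ≤ F := by
    have h2 : (2 : ℤ) ≤ n := by exact_mod_cast hn
    have h1 : (1 : ℤ) ≤ m := by exact_mod_cast hm1
    rw [hFdef]
    nlinarith
  have hFM : F + n ≤ (n : ℤ) * M0 μ := by
    have h : ((m + 1 : ℕ) : ℤ) ≤ M0 μ := by exact_mod_cast hm
    push_cast at h
    rw [hFdef]
    nlinarith
  have hF : F ≤ (n : ℤ) * M0 μ := by linarith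
  set v := vfun n M0 μ F with hv
  -- (1) symmetry: `⟨u, (−Δ+aP)v⟩ = ⟨(−Δ+aP)u, v⟩ = ⟨1_Ω, v⟩`
  have hsymm : u ⬝ᵥ (fineOpR n a 0 (boxDom fun i => n * M0 i) *ᵥ v) = ind n M0 μ m ⬝ᵥ v := by
    rw [Matrix.dotProduct_mulVec, ← Matrix.mulVec_transpose, (fineOpR_isSymm n a 0 (boxDom fun i => n * M0 i)).eq,
      hAu]
  -- (2) `⟨1_Ω, v⟩ = Σ v = #Ω − #layer`
  have hRHS : ind n M0 μ m ⬝ᵥ v = ((Finset.univ.filter fun y : Pt n M0 => blk n y.1 μ < (m : ℤ)).card : ℝ)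
      - ((layer n M0 μ (F - 1)).card : ℝ) := by
    have e : ∀ y : Pt n M0, ind n M0 μ m y * v y = ind n M0 μ m y - lay n M0 μ F y := by
      intro y
      rw [hv, ind_eq hn1, ← hFdef]
      simp only [vfun, lay]
      split_ifs <;> first | (exfalso; omega) | norm_num
    have s1 : ∑ y : Pt n M0, ind n M0 μ m y
        = ((Finset.univ.filter fun y : Pt n M0 => blk n y.1 μ < (m : ℤ)).card : ℝ) := by
      simp only [ind]
      rw [Finset.sum_boole]
    have s2 : ∑ y : Pt n M0, lay n M0 μ F y = ((layer n M0 μ (F - 1)).card : ℝ) := by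
      simp only [lay]
      rw [Finset.sum_boole]
      rfl
    rw [dotProduct, Finset.sum_congr rfl fun y _ => e y, Finset.sum_sub_distrib, s1, s2]
  -- (3) `⟨u, (−Δ+aP)v⟩` computed with the explicit action of the operator
  have hT2 : ∀ y : Pt n M0, ∑ z : Pt n M0, (if blk n z.1 = blk n y.1 then v z else 0)
      = (n : ℝ) ^ (d + 1) * ind n M0 μ m y
        - ∑ z : Pt n M0, (if blk n z.1 = blk n y.1 then lay n M0 μ F z else 0) := by
    intro y
    have e : ∀ z : Pt n M0, (if blk n z.1 = blk n y.1 then v z else 0)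
        = (if blk n z.1 = blk n y.1 then ind n M0 μ m y else 0)
          - (if blk n z.1 = blk n y.1 then lay n M0 μ F z else 0) := by
      intro z
      by_cases h : blk n z.1 = blk n y.1
      · rw [if_pos h, if_pos h, if_pos h, hv, vfun_eq hn1 m z, ← hFdef]
        simp only [ind, h]
      · rw [if_neg h, if_neg h, if_neg h, sub_zero]
    rw [Finset.sum_congr rfl fun z _ => e z, Finset.sum_sub_distrib, ← Finset.sum_filter, Finset.sum_const,
      nsmul_eq_mul, card_filter_blk hn1 M0 ⟨blk n y.1, blk_mem_boxDom hn1 y.2⟩]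
    push_cast
    rfl
  have hT1sum : ∑ y : Pt n M0, u y * ((if y.1 μ = F - 2 then (1 : ℝ) else 0) - (if y.1 μ = F - 1 then (1 : ℝ) else 0))
      = ∑ x ∈ layer n M0 μ (F - 2), (u x - u (shift μ 1 x)) := by
    have e1 : ∑ y : Pt n M0, u y * (if y.1 μ = F - 2 then (1 : ℝ) else 0) = ∑ y ∈ layer n M0 μ (F - 2), u y := by
      rw [layer, Finset.sum_filter]
      refine Finset.sum_congr rfl fun y _ => ?_
      split_ifs <;> simp
    have e2 : ∑ y : Pt n M0, u y * (if y.1 μ = F - 1 then (1 : ℝ) else 0) = ∑ y ∈ layer n M0 μ (F - 1), u y := by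
      rw [layer, Finset.sum_filter]
      refine Finset.sum_congr rfl fun y _ => ?_
      split_ifs <;> simp
    have e3 : F - 1 = F - 2 + 1 := by ring
    rw [Finset.sum_congr rfl fun y _ => mul_sub (u y) _ _, Finset.sum_sub_distrib, e1, e2, e3,
      sum_layer_succ μ (by linarith) (by linarith) u, ← Finset.sum_sub_distrib]
  have hLHS : u ⬝ᵥ (fineOpR n a 0 (boxDom fun i => n * M0 i) *ᵥ v)
      = (n : ℝ) ^ 2 * ∑ x ∈ layer n M0 μ (F - 2), (u x - u (shift μ 1 x))
        + a * ∑ y, ind n M0 μ m y * u y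
        - a * ((n : ℝ) ^ (d + 1))⁻¹ * ∑ y, u y
            * ∑ z : Pt n M0, (if blk n z.1 = blk n y.1 then lay n M0 μ F z else 0) := by
    have e : ∀ y : Pt n M0, u y * (fineOpR n a 0 (boxDom fun i => n * M0 i) *ᵥ v) y
        = (n : ℝ) ^ 2 * (u y * ((if y.1 μ = F - 2 then (1 : ℝ) else 0) - (if y.1 μ = F - 1 then (1 : ℝ) else 0)))
          + a * (ind n M0 μ m y * u y)
          - a * ((n : ℝ) ^ (d + 1))⁻¹ * (u y
              * ∑ z : Pt n M0, (if blk n z.1 = blk n y.1 then lay n M0 μ F z else 0)) := by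
      intro y
      rw [fineOpR_mulVec_apply, lap_vfun hF2 hF y, hT2 y, zero_mul, add_zero]
      have hnn : (n : ℝ) ^ (d + 1) ≠ 0 := by positivity
      field_simp
      ring
    rw [dotProduct, Finset.sum_congr rfl fun y _ => e y, Finset.sum_sub_distrib, Finset.sum_add_distrib,
      ← Finset.mul_sum, ← Finset.mul_sum, ← Finset.mul_sum, hT1sum]
  rw [← hLHS, hsymm, hRHS]

/-- **A POINT OF THE INNER LAYER WITH LARGE INWARD DROP.** If `|u| ≤ C` on `Ω₀`, some `x` with `x_μ = nm − 2` has
`u(x) − u(x + e_μ) ≥ (n/(2(1+a)) − 1 − aC)/n²`, i.e. the mesh derivative `∂^η_μ u(x) ≤ −(1/(2(1+a)) − (1+aC)/n)`.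
[folklore] -/
theorem exists_face_drop (hn : 2 ≤ n) (ha : 0 < a) (hm1 : 1 ≤ m) (hm : m + 1 ≤ M0 μ) (hM0 : ∀ j, 1 ≤ M0 j)
    {C : ℝ} (hC : ∀ y, |sol n a M0 μ m y| ≤ C) :
    ∃ x ∈ layer n M0 μ ((n : ℤ) * m - 2),
      (1 / (2 * (1 + a)) * n - 1 - a * C) / (n : ℝ) ^ 2 ≤ sol n a M0 μ m x - sol n a M0 μ m (shift μ 1 x) := by
  have hn1 : 1 ≤ n := le_trans (by norm_num) hn
  have hn0 : (0 : ℤ) < n := by exact_mod_cast hn1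
  have hnR : (0 : ℝ) < n := by exact_mod_cast hn1
  have hE := energy_bound (M0 := M0) (μ := μ) hn1 ha hm1 hm
  have hLI := layer_identity (M0 := M0) (μ := μ) a m hn ha hm1 hm
  have hEb := lay_block_sum_le (M0 := M0) (μ := μ) hn1 ((n : ℤ) * m) (sol n a M0 μ m) hC
  set u := sol n a M0 μ m with hu
  set F : ℤ := (n : ℤ) * m with hFdef
  set ε : ℝ := 1 / (2 * (1 + a)) with hε
  have hF2 : 2 ≤ F := by
    have h2 : (2 : ℤ) ≤ n := by exact_mod_cast hn
    have h1 : (1 : ℤ) ≤ m := by exact_mod_cast hm1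
    rw [hFdef]
    nlinarith
  have hFM : F + n ≤ (n : ℤ) * M0 μ := by
    have h : ((m + 1 : ℕ) : ℤ) ≤ M0 μ := by exact_mod_cast hm
    push_cast at h
    rw [hFdef]
    nlinarith
  have hM : (0 : ℤ) < (n : ℤ) * M0 μ := by linarith
  -- all layers have `Λ` points; `#B_in = nΛ`
  have hΛ1 : ((layer n M0 μ (F - 1)).card : ℝ) = (layer n M0 μ 0).card := by
    exact_mod_cast card_layer_eq μ (by linarith) (by linarith) le_rfl hM
  have hΛ2 : ((layer n M0 μ (F - 2)).card : ℝ) = (layer n M0 μ 0).card := by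
    exact_mod_cast card_layer_eq μ (by linarith) (by linarith) le_rfl hM
  have hm0 : (0 : ℤ) ≤ (m : ℤ) - 1 := by
    have : (1 : ℤ) ≤ m := by exact_mod_cast hm1
    linarith
  have hmM : (m : ℤ) - 1 + 1 ≤ (M0 μ : ℤ) := by
    have h : ((m + 1 : ℕ) : ℤ) ≤ M0 μ := by exact_mod_cast hm
    push_cast at h
    linarith
  have hBin : ((Finset.univ.filter fun y : Pt n M0 => blk n y.1 μ = (m : ℤ) - 1).card : ℝ)
      = n * (layer n M0 μ 0).card := by
    exact_mod_cast card_blockCol μ hn1 hm0 hmM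
  set Λ : ℝ := ((layer n M0 μ 0).card : ℝ) with hΛ
  -- the error term
  have hcE : |a * ((n : ℝ) ^ (d + 1))⁻¹ * ∑ y, u y
      * ∑ z : Pt n M0, (if blk n z.1 = blk n y.1 then lay n M0 μ F z else 0)| ≤ a * C * Λ := by
    rw [abs_mul, abs_of_pos (by positivity : (0 : ℝ) < a * ((n : ℝ) ^ (d + 1))⁻¹)]
    calc a * ((n : ℝ) ^ (d + 1))⁻¹ * |∑ y, u y
          * ∑ z : Pt n M0, (if blk n z.1 = blk n y.1 then lay n M0 μ F z else 0)|
        ≤ a * ((n : ℝ) ^ (d + 1))⁻¹ * (C * ((n : ℝ) ^ (d + 1) * ((layer n M0 μ (F - 1)).card : ℝ))) :=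
          mul_le_mul_of_nonneg_left hEb (by positivity)
      _ = a * C * Λ := by
          rw [hΛ1]
          have hnn : (n : ℝ) ^ (d + 1) ≠ 0 := by positivity
          field_simp
  have habs := abs_le.1 hcE
  -- `n²Φ ≥ Λ(εn − 1 − aC)`
  have hΦ : Λ * (ε * n - 1 - a * C)
      ≤ (n : ℝ) ^ 2 * ∑ x ∈ layer n M0 μ (F - 2), (u x - u (shift μ 1 x)) := by
    rw [hΛ1] at hLI
    rw [hBin] at hE
    nlinarith [hLI, hE, habs.1, habs.2]
  -- pigeonhole on the layer
  have hne : (layer n M0 μ (F - 2)).Nonempty := layer_nonempty μ hM0 hn1 (by linarith) (by linarith)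
  have hsum : ∑ x ∈ layer n M0 μ (F - 2), (ε * n - 1 - a * C) / (n : ℝ) ^ 2
      ≤ ∑ x ∈ layer n M0 μ (F - 2), (u x - u (shift μ 1 x)) := by
    rw [Finset.sum_const, nsmul_eq_mul, hΛ2, mul_div_assoc', div_le_iff₀ (by positivity)]
    linarith [hΦ]
  exact Finset.exists_le_of_sum_le hne hsum

end Layer

/-! ## §5 Uniform bounds and the geometry of the member -/

section Member

variable {n : ℕ} {a : ℝ}

/-- **`G(Ω₀)·1 = 1/a`** on a box: the row sums of `−Δ^{η,N}_{Ω₀} + aP_k` are `a`. [folklore] -/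
theorem boxGreen_one (hn : 1 ≤ n) (ha : 0 < a) (M0 : Fin (d + 1) → ℕ) :
    (fineOpR n a 0 (boxDom fun i => n * M0 i))⁻¹ *ᵥ (fun _ => (1 : ℝ)) = fun _ => 1 / a := by
  have h1 : fineOpR n a 0 (boxDom fun i => n * M0 i) *ᵥ (fun _ => 1 / a) = fun _ => (1 : ℝ) := by
    funext y
    rw [fineOpR_mulVec_apply]
    simp only [sub_self, ite_self, Finset.sum_const_zero, mul_zero, zero_add, zero_mul]
    rw [← Finset.sum_filter, Finset.sum_const, nsmul_eq_mul,
      card_filter_blk hn M0 ⟨blk n y.1, blk_mem_boxDom hn y.2⟩]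
    have hnn : (n : ℝ) ^ (d + 1) ≠ 0 := by positivity
    push_cast
    field_simp
  rw [← h1, Matrix.mulVec_mulVec, fineOpR_inv_mul hn ha.le (by rw [add_zero]; exact lt_min two_pos ha)
    (boxDom_isBlockUnion hn M0), Matrix.one_mulVec]

/-- the outer box of the member in big-block units: the inner cube `[0,Mb)^{d+1}` doubled in direction `μ`,
`M₀ = (Mb, …, 2Mb, …, Mb)`. [folklore] -/
def dblM (Mb : ℕ) (μ : Fin (d + 1)) : Fin (d + 1) → ℕ := fun j => if j = μ then 2 * Mb else Mb

/-- the doubled side. [folklore] -/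
theorem dblM_self (Mb : ℕ) (μ : Fin (d + 1)) : dblM Mb μ μ = 2 * Mb := by simp [dblM]

/-- the other sides. [folklore] -/
theorem dblM_ne (Mb : ℕ) {μ j : Fin (d + 1)} (h : j ≠ μ) : dblM Mb μ j = Mb := by simp [dblM, h]

/-- the inner cube fits in every direction. [folklore] -/
theorem le_dblM (Mb : ℕ) (μ j : Fin (d + 1)) : Mb ≤ dblM Mb μ j := by
  unfold dblM; split_ifs <;> omega

/-- the outer box has positive sides. [folklore] -/
theorem one_le_dblM {Mb : ℕ} (hMb : 1 ≤ Mb) (μ j : Fin (d + 1)) : 1 ≤ dblM Mb μ j :=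
  le_trans hMb (le_dblM Mb μ j)

/-- the nested pair `[0,Mb)^{d+1} ⊂ Π_j[0, M₀_j)` at offset `0` fits. [folklore] -/
theorem fits_dblM (Mb : ℕ) (μ : Fin (d + 1)) : Fits (fun _ : Fin (d + 1) => Mb) (dblM Mb μ) (fun _ => 0) :=
  fun j => ⟨le_rfl, by
    show (0 : ℤ) + (Mb : ℤ) ≤ (dblM Mb μ j : ℤ)
    rw [zero_add]
    exact_mod_cast le_dblM Mb μ j⟩

/-- a point of the outer fine box lies in the inner fine cube `[0, nMb)^{d+1}` iff `y_μ < nMb`. [folklore] -/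
theorem mem_inner_iff {Mb : ℕ} {μ : Fin (d + 1)} (y : Pt n (dblM Mb μ)) :
    y.1 ∈ boxDom (fun _ : Fin (d + 1) => n * Mb) ↔ y.1 μ < (n : ℤ) * Mb := by
  have hy := mem_boxDom.1 y.2
  rw [mem_boxDom]
  constructor
  · intro h
    have h2 := (h μ).2
    push_cast at h2
    exact h2
  · intro h j
    refine ⟨(hy j).1, ?_⟩
    by_cases hj : j = μ
    · subst hj
      push_cast
      exact h
    · have h2 := (hy j).2
      simp only [dblM, if_neg hj] at h2
      simpa using h2

/-- the extension by zero of `1_Ω` to the outer box is the indicator `1_Ω = [⌊y_μ/n⌋ < Mb]`. [folklore] -/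
theorem ext_one_eq_ind (hn : 1 ≤ n) (Mb : ℕ) (μ : Fin (d + 1)) :
    B4Delta112ZeroBox.ext n (fun _ : Fin (d + 1) => Mb) (dblM Mb μ) (fun _ => 0) (fun _ => (1 : ℝ))
      = ind n (dblM Mb μ) μ Mb := by
  funext y
  rw [ind_eq hn]
  have h0 : (y.1 - fun i => (n : ℤ) * (fun _ : Fin (d + 1) => (0 : ℤ)) i) = y.1 := by
    funext j; simp
  by_cases hy : y.1 μ < (n : ℤ) * Mb
  · have hmem : (y.1 - fun i => (n : ℤ) * (fun _ : Fin (d + 1) => (0 : ℤ)) i)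
        ∈ boxDom (fun i => n * (fun _ : Fin (d + 1) => Mb) i) := by
      rw [h0]; exact (mem_inner_iff y).2 hy
    rw [B4Delta112ZeroBox.ext_of_mem _ hmem, if_pos hy]
  · have hnm : (y.1 - fun i => (n : ℤ) * (fun _ : Fin (d + 1) => (0 : ℤ)) i)
        ∉ boxDom (fun i => n * (fun _ : Fin (d + 1) => Mb) i) := by
      rw [h0]; exact fun h => hy ((mem_inner_iff y).1 h)
    rw [B4Delta112ZeroBox.ext_of_not_mem _ hnm, if_neg hy]

/-- **THE LINEAGE'S `δG·1` OF THE PAIR IS `1/a − u`**: `δG_k(Ω,Ω₀,0)1 = G(Ω)1 − (G(Ω₀)1_Ω)|_Ω = 1/a − u|_Ω`.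
[cite: Balaban1983RegularityDecay, p. 573 (1.11), case A = 0, dictionary] -/
theorem dG9_one_apply (hn : 1 ≤ n) (ha : 0 < a) (Mb : ℕ) (μ : Fin (d + 1))
    (y : ↥(boxDom fun _ : Fin (d + 1) => n * Mb)) (hy0 : y.1 ∈ boxDom fun i => n * dblM Mb μ i) :
    B4Delta112ZeroBox.dG n a 0 (fits_dblM Mb μ) (fun _ => (1 : ℝ)) y
      = 1 / a - sol n a (dblM Mb μ) μ Mb ⟨y.1, hy0⟩ := by
  have hemb : emb ((fits_dblM Mb μ).scale n) y = ⟨y.1, hy0⟩ :=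
    Subtype.ext (by rw [emb_val]; funext j; simp)
  unfold B4Delta112ZeroBox.dG
  rw [hemb, ← fineOpR_boxDom, ← fineOpR_boxDom, boxGreen_one hn ha, ext_one_eq_ind hn Mb μ]
  rfl

/-- the translation of the member's outer box is `0`: `emb` fixes coordinates. [folklore] -/
theorem supNorm_add_uvec_sub (x : Fin (d + 1) → ℤ) (μ : Fin (d + 1)) : supNorm (x + uvec μ - x) = 1 := by
  have h1 : supNorm (x + uvec μ - x) ≤ 1 :=
    supNorm_sub_le_one_of_mem_nbrs (mem_nbrs.2 ⟨μ, Or.inr (add_sub_cancel_right x (uvec μ)).symm⟩)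
  have h2 := abs_le_supNorm (x + uvec μ - x) μ
  have h3 : (x + uvec μ - x) μ = 1 := by simp [uvec_apply_same]
  rw [h3] at h2
  simp only [abs_one, Int.cast_one] at h2
  exact le_antisymm h1 h2

/-- `(1/n)^{−α} = n^α`. [folklore] -/
theorem one_div_rpow_neg (hn : 1 ≤ n) (α : ℝ) : (1 / (n : ℝ)) ^ (-α) = (n : ℝ) ^ α := by
  have h0 : (0 : ℝ) ≤ n := Nat.cast_nonneg n
  rw [Real.rpow_neg (by positivity), one_div, Real.inv_rpow h0, inv_inv]

/-- four factors each at most one. [folklore] -/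
theorem rhs_le4 {c₀ E1 E2 S : ℝ} (h1 : 0 ≤ E1) (h1' : E1 ≤ 1) (h2 : 0 ≤ E2) (h2' : E2 ≤ 1) (hS : 0 ≤ S)
    (hS' : S ≤ 1) : c₀ * E1 * E2 * S ≤ |c₀| := by
  have hP : 0 ≤ E1 * E2 * S := by positivity
  have hc : c₀ * E1 * E2 * S ≤ |c₀| * E1 * E2 * S := by nlinarith [le_abs_self c₀]
  calc c₀ * E1 * E2 * S ≤ |c₀| * E1 * E2 * S := hc
    _ ≤ |c₀| * 1 * 1 * 1 :=
        mul_le_mul (mul_le_mul (mul_le_mul_of_nonneg_left h1' (abs_nonneg _)) h2' h2 (by positivity)) hS' hS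
          (by positivity)
    _ = |c₀| := by ring

/-- there are arbitrarily fine meshes `η = L^{-k}`. [folklore] -/
theorem exists_scale {ℓ : ℕ} (hℓ : 1 ≤ ℓ) (X : ℝ) : ∃ k : ℕ, 1 ≤ k ∧ X < (((ℓ + 1) ^ k : ℕ) : ℝ) := by
  have hL : (1 : ℝ) < ((ℓ + 1 : ℕ) : ℝ) := by exact_mod_cast (by omega : 1 < ℓ + 1)
  obtain ⟨k, hk⟩ := pow_unbounded_of_one_lt X hL
  refine ⟨k + 1, Nat.succ_pos k, lt_of_lt_of_le hk ?_⟩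
  rw [Nat.cast_pow]
  exact pow_le_pow_right₀ hL.le (Nat.le_succ k)

variable {ℓ : ℕ} {m2plus : ℝ}

/-- the outer box as a member of node 12's box family (to read off the sup bound of `u`). [folklore] -/
def outerInst (ℓ : ℕ) (k : ℕ) (hk : 1 ≤ k) (M0 : Fin (d + 1) → ℕ) (hM0 : ∀ j, 1 ≤ M0 j) : BoxInst d ℓ 0 where
  k := k
  hk := hk
  M := M0
  hM := hM0
  R₀ := boxDom (fun j => (ℓ + 1) ^ k * M0 j)
  hR₀ := boxDom_isBlockUnion (BoxInst.one_le_Lk ℓ k) M0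
  hsub := Finset.Subset.refl _
  m2 := 0
  hm := le_rfl
  hm' := le_rfl
  e := 0

/-- three factors, the last two at most one. [folklore] -/
theorem bound_collapse {C E S : ℝ} (hC : 0 ≤ C) (hE : E ≤ 1) (hS0 : 0 ≤ S) (hS : S ≤ 1) :
    C * E * S ≤ C := by
  calc C * E * S ≤ C * 1 * 1 := mul_le_mul (mul_le_mul_of_nonneg_left hE hC) hS hS0 (by positivity)
    _ = C := by ring

/-- **`u = G(Ω₀)1_Ω` IS BOUNDED UNIFORMLY IN THE MESH**: `|u| ≤ C(d, L, a)` on every box `Ω₀` at every scale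
(node 12's `η`-uniform (1.10) value bound `valG_bound` with `‖1_Ω‖_∞ ≤ 1`).
[cite: Balaban1983RegularityDecay, Theorem p. 573 (1.10), case A = 0, Ω a box] -/
theorem exists_sol_bound (hℓ : 1 ≤ ℓ) (ha : 0 < a) :
    ∃ C : ℝ, 0 < C ∧ ∀ (k : ℕ) (hk : 1 ≤ k) (M0 : Fin (d + 1) → ℕ) (hM0 : ∀ j, 1 ≤ M0 j) (μ : Fin (d + 1)) (m : ℕ)
      (y : Pt ((ℓ + 1) ^ k) M0), |sol ((ℓ + 1) ^ k) a M0 μ m y| ≤ C := by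
  obtain ⟨δ, C, hδ, hC, h⟩ := valG_bound (d := d) (m2plus := (0 : ℝ)) hℓ a ha
  refine ⟨C, hC, fun k hk M0 hM0 μ m y => ?_⟩
  have key : |sol ((ℓ + 1) ^ k) a M0 μ m y|
      ≤ C * Real.exp (-(δ * setDist (edistR (outerInst ℓ k hk M0 hM0).toZF.n (outerInst ℓ k hk M0 hM0).toZF.R)
          {y} (supp (ind ((ℓ + 1) ^ k) M0 μ m))))
        * (outerInst ℓ k hk M0 hM0).toZF.supN (ind ((ℓ + 1) ^ k) M0 μ m) :=
    h (outerInst ℓ k hk M0 hM0) (ind ((ℓ + 1) ^ k) M0 μ m) y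
  have hs : 0 ≤ setDist (edistR (outerInst ℓ k hk M0 hM0).toZF.n (outerInst ℓ k hk M0 hM0).toZF.R) {y}
      (supp (ind ((ℓ + 1) ^ k) M0 μ m)) := setDist_edistR_nonneg _ _
  have hE : Real.exp (-(δ * setDist (edistR (outerInst ℓ k hk M0 hM0).toZF.n (outerInst ℓ k hk M0 hM0).toZF.R)
      {y} (supp (ind ((ℓ + 1) ^ k) M0 μ m)))) ≤ 1 :=
    Real.exp_le_one_iff.2 (by have := mul_nonneg hδ.le hs; linarith)
  have hS : (outerInst ℓ k hk M0 hM0).toZF.supN (ind ((ℓ + 1) ^ k) M0 μ m) ≤ 1 :=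
    supN_le_of_forall_le (i := (outerInst ℓ k hk M0 hM0).toZF) _ zero_le_one fun z => abs_ind_le_one z
  exact key.trans (bound_collapse hC.le hE (supN_nonneg _ _) hS)

/-- **THE MEMBER**: scale `k`, inner box = ONE big block `Ω = [0,Mb)^{d+1}`, outer box `Ω₀ = Ω ∪ (Ω + Mb·e_μ)` (two
big blocks along `μ`), offset `0`, mass `0`, charge `e`. [folklore] -/
def slab (ℓ : ℕ) {m2plus : ℝ} (hm2 : 0 ≤ m2plus) (k : ℕ) (hk : 1 ≤ k) (Mb : ℕ) (hMb : 1 ≤ Mb) (μ : Fin (d + 1))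
    (e : ℝ) : NestInst d ℓ m2plus where
  k := k
  hk := hk
  M := fun _ => Mb
  M0 := dblM Mb μ
  s := fun _ => 0
  hs := fits_dblM Mb μ
  hM := fun _ => hMb
  m2 := 0
  hm := le_rfl
  hm' := hm2
  e := e

/-- THE MEMBER MEETS EVERY TYPED ANTECEDENT of the leaf: `regular` (void at `A = 0`), `bigBlocks` (`Ω` and `Ω₀` are
unions of big blocks of side `Mb`), charge `e`. [folklore] -/
theorem slab_hypotheses (hm2 : 0 ≤ m2plus) (a : ℝ) (g : ∀ i : ZeroFieldInstance d, (↥i.R → ℝ) → ℝ) (k : ℕ)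
    (hk : 1 ≤ k) {Mb : ℕ} (hMb : 1 ≤ Mb) (μ : Fin (d + 1)) (e : ℝ) :
    (nestFamB ℓ m2plus a Mb g (slab ℓ hm2 k hk Mb hMb μ e)).regular ∧
      (nestFamB ℓ m2plus a Mb g (slab ℓ hm2 k hk Mb hMb μ e)).bigBlocks ∧
      (nestFamB ℓ m2plus a Mb g (slab ℓ hm2 k hk Mb hMb μ e)).e = e := by
  have hMn : 1 ≤ Mb * (ℓ + 1) ^ k := by simpa using Nat.mul_le_mul hMb (BoxInst.one_le_Lk ℓ k)
  have h1 : IsBlockUnion (Mb * (ℓ + 1) ^ k) (boxDom fun _ : Fin (d + 1) => (ℓ + 1) ^ k * Mb) :=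
    boxDom_isBlockUnion_of_dvd hMn fun _ => ⟨1, by ring⟩
  have h2 : IsBlockUnion (Mb * (ℓ + 1) ^ k) (shiftBox ((ℓ + 1) ^ k) (dblM Mb μ) fun _ => (0 : ℤ)) :=
    shiftBox_isBlockUnion_of_dvd hMn
      (fun j => ⟨if j = μ then 2 else 1, by unfold dblM; split_ifs <;> ring⟩) (fun _ => ⟨0, by simp⟩)
  exact ⟨trivial, ⟨h1, h2⟩, rfl⟩

/-- the inner box is a rectangular parallelepiped, so the typed antecedent `rect ∨ …` of (1.11) is met for EVERY
pair of points (node 12's `BoxInst.rect` is the same proposition). [folklore] -/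
theorem slab_rect (hm2 : 0 ≤ m2plus) (a : ℝ) (g : ∀ i : ZeroFieldInstance d, (↥i.R → ℝ) → ℝ) (k : ℕ)
    (hk : 1 ≤ k) (Mb : ℕ) (hMb : 1 ≤ Mb) (μ : Fin (d + 1)) (e : ℝ) :
    (nestFamB ℓ m2plus a Mb g (slab ℓ hm2 k hk Mb hMb μ e)).rect :=
  BoxInst.rect a Mb g (slab ℓ hm2 k hk Mb hMb μ e).toBox

/-- the outer region of the member is strictly larger: the fine point `nMb·e_μ` lies in `Ω₀∖Ω`. [folklore] -/
theorem slab_outR_nonempty (hm2 : 0 ≤ m2plus) (k : ℕ) (hk : 1 ≤ k) (Mb : ℕ) (hMb : 1 ≤ Mb) (μ : Fin (d + 1))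
    (e : ℝ) : (outR (slab (d := d) ℓ hm2 k hk Mb hMb μ e).toZF.R (slab (d := d) ℓ hm2 k hk Mb hMb μ e).toZF.R₀).Nonempty := by
  have hL : 1 ≤ (ℓ + 1) ^ k := BoxInst.one_le_Lk ℓ k
  have hMn : (1 : ℤ) ≤ ((ℓ + 1) ^ k : ℕ) * (Mb : ℤ) := by
    have h1 : (1 : ℤ) ≤ ((ℓ + 1) ^ k : ℕ) := by exact_mod_cast hL
    have h2 : (1 : ℤ) ≤ Mb := by exact_mod_cast hMb
    nlinarith
  have hmem : (Pi.single μ ((((ℓ + 1) ^ k : ℕ) : ℤ) * Mb) : Fin (d + 1) → ℤ)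
      ∈ shiftBox ((ℓ + 1) ^ k) (dblM Mb μ) (fun _ => (0 : ℤ)) := by
    rw [mem_shiftBox, mem_boxDom]
    intro j
    by_cases hj : j = μ
    · subst hj
      simp only [Pi.add_apply, Pi.single_eq_same, mul_zero, add_zero, dblM_self]
      push_cast
      constructor <;> nlinarith
    · simp only [Pi.add_apply, Pi.single_eq_of_ne hj, mul_zero, add_zero, dblM_ne Mb hj]
      push_cast
      exact ⟨by norm_num, by nlinarith⟩
  have hnot : (Pi.single μ ((((ℓ + 1) ^ k : ℕ) : ℤ) * Mb) : Fin (d + 1) → ℤ)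
      ∉ boxDom (fun _ : Fin (d + 1) => (ℓ + 1) ^ k * Mb) := by
    intro h
    have := (mem_boxDom.1 h μ).2
    rw [Pi.single_eq_same] at this
    push_cast at this
    exact lt_irrefl _ this
  exact ⟨⟨_, hmem⟩, by
    unfold outR
    rw [Finset.mem_filter]
    exact ⟨Finset.mem_univ _, hnot⟩⟩

end Member

/-! ## §6 The violated (1.11)·(1.12) Hölder clause and the kernel refutation of `ThmPrintedNN` on `nestFamB` -/

section Refutation

variable {ℓ : ℕ} {m2plus : ℝ} {a : ℝ}

/-- **THE HÖLDER QUOTIENT OF `∂^η_μ δG_k(Ω,Ω₀,0)·1` ACROSS THE FACE OF `Ω` IS AT LEAST `n^α·(ε − (1+aC)/n)`**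
(`n = L^k`, `ε = 1/(2(1+a))`, `|u| ≤ C`): at the pair `x′` (one layer inside the face of `Ω` adjacent to `Ω₀∖Ω`,
the point of `exists_face_drop`) and `x = x′ + e_μ` (on the face), b04's verbatim field reads
`dlhs19 = (η·1)^{−α}·|D^η_{0,μ}(1/a − u)(x′) − 0| ≥ n^α · n(u(x′) − u(x′+e_μ))` — the forward bond at `x` LEAVES `Ω`,
so the typed `B4Cor23Zero.fdiff` vanishes there (OBSERVATION (O-bond) of `B4Ineq19ZeroBoxEta`).
[cite: Balaban1983RegularityDecay, Theorem p. 573 (1.11)–(1.12), case A = 0 — the verbatim carrier's reading] -/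
theorem dlhs19_slab_ge (hℓ : 1 ≤ ℓ) (hm2 : 0 ≤ m2plus) (ha : 0 < a) {Mb : ℕ} (hMb : 1 ≤ Mb)
    (g : ∀ i : ZeroFieldInstance d, (↥i.R → ℝ) → ℝ) (k : ℕ) (hk : 1 ≤ k) (μ : Fin (d + 1)) (e : ℝ) {C : ℝ}
    (hC : ∀ y : Pt ((ℓ + 1) ^ k) (dblM Mb μ), |sol ((ℓ + 1) ^ k) a (dblM Mb μ) μ Mb y| ≤ C) (α : ℝ) :
    ∃ x x' : (nestFamB ℓ m2plus a Mb g (slab ℓ hm2 k hk Mb hMb μ e)).Site,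
      (((ℓ + 1) ^ k : ℕ) : ℝ) ^ α
          * ((1 / (2 * (1 + a)) * (((ℓ + 1) ^ k : ℕ) : ℝ) - 1 - a * C) / (((ℓ + 1) ^ k : ℕ) : ℝ))
        ≤ (nestFamB ℓ m2plus a Mb g (slab ℓ hm2 k hk Mb hMb μ e)).dlhs19 α μ (fun _ => 1) x x' := by
  set n : ℕ := (ℓ + 1) ^ k with hndef
  have hn2 : 2 ≤ n := two_le_Lk hℓ hk
  have hn1 : 1 ≤ n := le_trans one_le_two hn2
  have hn0 : (0 : ℤ) < n := by exact_mod_cast hn1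
  have hnR : (0 : ℝ) < n := by exact_mod_cast hn1
  have hm : Mb + 1 ≤ dblM Mb μ μ := by rw [dblM_self]; omega
  obtain ⟨xpt, hxl, hdrop⟩ := exists_face_drop a Mb hn2 ha hMb hm (one_le_dblM hMb μ) hC
  set u := sol n a (dblM Mb μ) μ Mb with hu
  have hxμ : xpt.1 μ = (n : ℤ) * Mb - 2 := mem_layer.1 hxl
  have hMb1 : (1 : ℤ) ≤ Mb := by exact_mod_cast hMb
  -- the two points and their bonds
  have hin0 : xpt.1 ∈ boxDom (fun _ : Fin (d + 1) => n * Mb) := (mem_inner_iff xpt).2 (by rw [hxμ]; linarith)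
  have hin1 : xpt.1 + uvec μ ∈ boxDom (fun _ : Fin (d + 1) => n * Mb) := by
    have h0 := mem_boxDom.1 hin0
    rw [mem_boxDom]
    intro j
    by_cases hj : j = μ
    · subst hj
      rw [Pi.add_apply, uvec_apply_same, hxμ]
      push_cast
      constructor <;> nlinarith
    · rw [Pi.add_apply, uvec_apply_ne hj, add_zero]
      exact h0 j
  have hout2 : xpt.1 + uvec μ + uvec μ ∉ boxDom (fun _ : Fin (d + 1) => n * Mb) := by
    intro h
    have h2 := (mem_boxDom.1 h μ).2
    rw [Pi.add_apply, Pi.add_apply, uvec_apply_same, hxμ] at h2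
    push_cast at h2
    linarith
  have hsh1 : xpt.1 + (1 : ℤ) • uvec μ ∈ boxDom (fun i => n * dblM Mb μ i) :=
    add_smul_uvec_mem μ xpt.2 (by rw [hxμ]; nlinarith) (by rw [hxμ, dblM_self]; push_cast; nlinarith)
  have hsh : xpt.1 + uvec μ ∈ boxDom (fun i => n * dblM Mb μ i) := by rwa [one_smul] at hsh1
  have hshift : (⟨xpt.1 + uvec μ, hsh⟩ : Pt n (dblM Mb μ)) = shift μ 1 xpt :=
    Subtype.ext (by rw [shift_val μ hsh1, one_smul])
  refine ⟨⟨xpt.1 + uvec μ, hin1⟩, ⟨xpt.1, hin0⟩, ?_⟩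
  -- the field `δG·1` of the member at the two relevant points
  set ψ : ↥(slab ℓ hm2 k hk Mb hMb μ e).toZF.R → ℝ :=
    B4Cor23ZeroDelta.dG (slab ℓ hm2 k hk Mb hMb μ e).toZF.n a (slab ℓ hm2 k hk Mb hMb μ e).toZF.m2
      (slab ℓ hm2 k hk Mb hMb μ e).toZF.hsub (fun _ => (1 : ℝ)) with hψdef
  have v0 : ψ ⟨xpt.1, hin0⟩ = 1 / a - u xpt :=
    (NestInst.dG_eq a (slab ℓ hm2 k hk Mb hMb μ e) (fun _ => 1) ⟨xpt.1, hin0⟩).trans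
      (dG9_one_apply hn1 ha Mb μ ⟨xpt.1, hin0⟩ xpt.2)
  have v1 : ∀ h : xpt.1 + uvec μ ∈ boxDom (fun _ : Fin (d + 1) => n * Mb), ψ ⟨xpt.1 + uvec μ, h⟩
      = 1 / a - u (shift μ 1 xpt) := by
    intro h
    rw [← hshift]
    exact (NestInst.dG_eq a (slab ℓ hm2 k hk Mb hMb μ e) (fun _ => 1) ⟨xpt.1 + uvec μ, h⟩).trans
      (dG9_one_apply hn1 ha Mb μ ⟨xpt.1 + uvec μ, h⟩ hsh)
  -- the verbatim field at the pair
  show (n : ℝ) ^ α * ((1 / (2 * (1 + a)) * n - 1 - a * C) / n)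
    ≤ edistR n (boxDom fun _ : Fin (d + 1) => n * Mb) ⟨xpt.1 + uvec μ, hin1⟩ ⟨xpt.1, hin0⟩ ^ (-α)
      * |fdiff n (boxDom fun _ : Fin (d + 1) => n * Mb) μ ψ ⟨xpt.1, hin0⟩
          - fdiff n (boxDom fun _ : Fin (d + 1) => n * Mb) μ ψ ⟨xpt.1 + uvec μ, hin1⟩|
  have hed : edistR n (boxDom fun _ : Fin (d + 1) => n * Mb) ⟨xpt.1 + uvec μ, hin1⟩ ⟨xpt.1, hin0⟩ = 1 / n := by
    unfold edistR
    show 1 / (n : ℝ) * supNorm (xpt.1 + uvec μ - xpt.1) = 1 / n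
    rw [supNorm_add_uvec_sub, mul_one]
  rw [hed, one_div_rpow_neg hn1]
  rw [fdiff_of_mem (R := boxDom fun _ : Fin (d + 1) => n * Mb) (x := ⟨xpt.1, hin0⟩) ψ hin1,
    fdiff_of_not_mem (R := boxDom fun _ : Fin (d + 1) => n * Mb) (x := ⟨xpt.1 + uvec μ, hin1⟩) ψ hout2]
  have e0 : ψ (⟨xpt.1, hin0⟩ : ↥(boxDom fun _ : Fin (d + 1) => n * Mb)) = 1 / a - u xpt := v0
  have e1 : ψ (⟨(⟨xpt.1, hin0⟩ : ↥(boxDom fun _ : Fin (d + 1) => n * Mb)).1 + uvec μ, hin1⟩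
      : ↥(boxDom fun _ : Fin (d + 1) => n * Mb)) = 1 / a - u (shift μ 1 xpt) := v1 hin1
  rw [e1, e0, sub_zero]
  have hpow : 0 ≤ (n : ℝ) ^ α := Real.rpow_nonneg hnR.le α
  have hcore : (n : ℝ) * (u xpt - u (shift μ 1 xpt))
      ≤ |(n : ℝ) * ((1 / a - u (shift μ 1 xpt)) - (1 / a - u xpt))| := by
    calc (n : ℝ) * (u xpt - u (shift μ 1 xpt)) = (n : ℝ) * ((1 / a - u (shift μ 1 xpt)) - (1 / a - u xpt)) := by
          ring
      _ ≤ _ := le_abs_self _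
  have hdrop' : ((1 / (2 * (1 + a)) * n - 1 - a * C) / n) ≤ (n : ℝ) * (u xpt - u (shift μ 1 xpt)) := by
    have h1 := mul_le_mul_of_nonneg_left hdrop hnR.le
    calc ((1 / (2 * (1 + a)) * n - 1 - a * C) / n)
        = (n : ℝ) * ((1 / (2 * (1 + a)) * n - 1 - a * C) / (n : ℝ) ^ 2) := by
          field_simp
      _ ≤ _ := h1
  exact le_trans (mul_le_mul_of_nonneg_left hdrop' hpow) (mul_le_mul_of_nonneg_left hcore hpow)

/-- **THE RIGHT-HAND SIDE OF (1.11)·(1.12) AT `f = 1` IS AT MOST `|c₀|`** (every `δ₀ ≥ 0`, every boundary assignment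
`g ≥ 0`): both exponential factors are `≤ 1` and `‖1‖_∞ ≤ 1`. [folklore] -/
theorem rhs112_slab_le (hm2 : 0 ≤ m2plus) {Mb : ℕ} (hMb : 1 ≤ Mb) {g : ∀ i : ZeroFieldInstance d, (↥i.R → ℝ) → ℝ}
    (hg : ∀ i f, 0 ≤ g i f) (k : ℕ) (hk : 1 ≤ k) (μ : Fin (d + 1)) (e : ℝ) {δ₀ : ℝ} (hδ : 0 ≤ δ₀) (c₀ : ℝ)
    (x x' : (nestFamB ℓ m2plus a Mb g (slab ℓ hm2 k hk Mb hMb μ e)).Site) :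
    c₀ * Real.exp (-(δ₀ * (nestFamB ℓ m2plus a Mb g (slab ℓ hm2 k hk Mb hMb μ e)).sdist2 x x' (fun _ => 1)))
        * Real.exp (-(δ₀ * (nestFamB ℓ m2plus a Mb g (slab ℓ hm2 k hk Mb hMb μ e)).bdist2 x x'
            + δ₀ * (nestFamB ℓ m2plus a Mb g (slab ℓ hm2 k hk Mb hMb μ e)).bdistS (fun _ => 1)))
        * (nestFamB ℓ m2plus a Mb g (slab ℓ hm2 k hk Mb hMb μ e)).supNorm (fun _ => 1) ≤ |c₀| := by
  have hs : 0 ≤ (nestFamB ℓ m2plus a Mb g (slab ℓ hm2 k hk Mb hMb μ e)).sdist2 x x' (fun _ => 1) :=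
    setDist_edistR_nonneg _ _
  have hb : 0 ≤ (nestFamB ℓ m2plus a Mb g (slab ℓ hm2 k hk Mb hMb μ e)).bdist2 x x' := setDist_edistR_nonneg _ _
  have hgS : 0 ≤ (nestFamB ℓ m2plus a Mb g (slab ℓ hm2 k hk Mb hMb μ e)).bdistS (fun _ => 1) := hg _ _
  have hE1 : Real.exp (-(δ₀ * (nestFamB ℓ m2plus a Mb g (slab ℓ hm2 k hk Mb hMb μ e)).sdist2 x x' (fun _ => 1))) ≤ 1 :=
    Real.exp_le_one_iff.2 (by have := mul_nonneg hδ hs; linarith)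
  have hE2 : Real.exp (-(δ₀ * (nestFamB ℓ m2plus a Mb g (slab ℓ hm2 k hk Mb hMb μ e)).bdist2 x x'
      + δ₀ * (nestFamB ℓ m2plus a Mb g (slab ℓ hm2 k hk Mb hMb μ e)).bdistS (fun _ => 1))) ≤ 1 :=
    Real.exp_le_one_iff.2 (by have := mul_nonneg hδ hb; have := mul_nonneg hδ hgS; linarith)
  have hS : (nestFamB ℓ m2plus a Mb g (slab ℓ hm2 k hk Mb hMb μ e)).supNorm (fun _ => 1) ≤ 1 :=
    supN_le_of_forall_le (i := (slab ℓ hm2 k hk Mb hMb μ e).toZF) _ zero_le_one fun _ => by norm_num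
  exact rhs_le4 (Real.exp_pos _).le hE1 (Real.exp_pos _).le hE2
    (supN_nonneg (slab ℓ hm2 k hk Mb hMb μ e).toZF _) hS

/-- **(1.11)·(1.12) FAILS ON THE MEMBER AT A FINE ENOUGH MESH** (b04's verbatim carrier, any `α`, any `δ₀ ≥ 0`,
`c₀`, `R₀`): if `|u| ≤ C` at scale `k` and `n = L^k` satisfies `n ≥ 4(1+a)(1+aC)` and `n^α > 4(1+a)|c₀|` (possible
for every `α > 0` at a fine enough mesh), the Hölder clause of `Ineq111_112` is violated at `μ`, `f = 1`, the face
pair of `dlhs19_slab_ge`. [folklore] -/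
theorem ineq112_slab_fails (hℓ : 1 ≤ ℓ) (hm2 : 0 ≤ m2plus) (ha : 0 < a) {Mb : ℕ} (hMb : 1 ≤ Mb)
    {g : ∀ i : ZeroFieldInstance d, (↥i.R → ℝ) → ℝ} (hg : ∀ i f, 0 ≤ g i f) (k : ℕ) (hk : 1 ≤ k)
    (μ : Fin (d + 1)) (e : ℝ) {C : ℝ}
    (hC : ∀ y : Pt ((ℓ + 1) ^ k) (dblM Mb μ), |sol ((ℓ + 1) ^ k) a (dblM Mb μ) μ Mb y| ≤ C)
    {α : ℝ} {δ₀ : ℝ} (hδ : 0 ≤ δ₀) {c₀ : ℝ} (R₀ : ℝ)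
    (hn1 : 2 * (1 + a * C) / (1 / (2 * (1 + a))) ≤ (((ℓ + 1) ^ k : ℕ) : ℝ))
    (hn2 : 2 * |c₀| / (1 / (2 * (1 + a))) < (((ℓ + 1) ^ k : ℕ) : ℝ) ^ α) :
    ¬ Ineq111_112 (nestFamB ℓ m2plus a Mb g (slab ℓ hm2 k hk Mb hMb μ e)) α δ₀ c₀ R₀ := by
  intro H
  set n : ℕ := (ℓ + 1) ^ k with hndef
  set ε : ℝ := 1 / (2 * (1 + a)) with hε
  have hε0 : 0 < ε := by positivity
  have hn1' : 1 ≤ n := le_trans one_le_two (two_le_Lk hℓ hk)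
  have hnR : (0 : ℝ) < n := by exact_mod_cast hn1'
  have hC0 : 0 ≤ C := le_trans (abs_nonneg _) (hC ⟨fun _ => 0, by
    rw [mem_boxDom]
    intro j
    refine ⟨le_rfl, ?_⟩
    have := one_le_dblM hMb μ j
    push_cast
    have h1 : (1 : ℤ) ≤ dblM Mb μ j := by exact_mod_cast this
    have h2 : (1 : ℤ) ≤ n := by exact_mod_cast hn1'
    nlinarith⟩)
  obtain ⟨x, x', hlow⟩ := dlhs19_slab_ge hℓ hm2 ha hMb g k hk μ e hC α
  have h1 := H.1 μ (fun _ => 1) x x' (Or.inl (slab_rect hm2 a g k hk Mb hMb μ e))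
  have h2 := rhs112_slab_le (ℓ := ℓ) (a := a) hm2 hMb hg k hk μ e hδ c₀ x x'
  have hchain : (n : ℝ) ^ α * ((ε * n - 1 - a * C) / n) ≤ |c₀| := (hlow.trans h1).trans h2
  have hq : ε / 2 ≤ (ε * n - 1 - a * C) / n := by
    rw [le_div_iff₀ hnR]
    have := (div_le_iff₀ hε0).1 hn1
    linarith
  have hpow : 0 ≤ (n : ℝ) ^ α := Real.rpow_nonneg hnR.le α
  have h3 : (n : ℝ) ^ α * (ε / 2) ≤ |c₀| := le_trans (mul_le_mul_of_nonneg_left hq hpow) hchain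
  have h4 : 2 * |c₀| < (n : ℝ) ^ α * ε := (div_lt_iff₀ hε0).1 hn2
  linarith

/-- **A MEMBER VIOLATING (1.11)·(1.12), FOR EVERY `α > 0` AND EVERY CHOICE OF CONSTANTS** (b04's verbatim carrier
`nestFamB`, every boundary assignment `g ≥ 0`): given `α > 0`, `δ₀ ≥ 0`, `c₀`, `R₀`, `e₁`, the member `slab` at a fine
enough scale `k(d, L, a, c₀, α)` with charge `e₁` meets the typed antecedents `regular`, `bigBlocks`, `e = e₁` and
violates `Ineq111_112`. [cite: Balaban1983RegularityDecay, Theorem p. 573 (1.11)–(1.12), case A = 0, Ω ⊂ Ω₀ nested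
boxes — the verbatim carrier's unguarded Hölder field `dlhs19`] -/
theorem exists_member_violating (hℓ : 1 ≤ ℓ) (hm2 : 0 ≤ m2plus) (ha : 0 < a) {Mb : ℕ} (hMb : 1 ≤ Mb)
    {g : ∀ i : ZeroFieldInstance d, (↥i.R → ℝ) → ℝ} (hg : ∀ i f, 0 ≤ g i f) (μ : Fin (d + 1)) {α : ℝ}
    (hα : 0 < α) {δ₀ : ℝ} (hδ : 0 ≤ δ₀) (c₀ R₀ e₁ : ℝ) :
    ∃ i : NestInst d ℓ m2plus, (nestFamB ℓ m2plus a Mb g i).regular ∧ (nestFamB ℓ m2plus a Mb g i).bigBlocks ∧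
      (nestFamB ℓ m2plus a Mb g i).e = e₁ ∧ ¬ Ineq111_112 (nestFamB ℓ m2plus a Mb g i) α δ₀ c₀ R₀ := by
  obtain ⟨C, hC0, hC⟩ := exists_sol_bound (d := d) hℓ ha
  set ε : ℝ := 1 / (2 * (1 + a)) with hε
  have hε0 : 0 < ε := by positivity
  obtain ⟨k, hk, hkX⟩ := exists_scale hℓ (max (2 * (1 + a * C) / ε) ((2 * |c₀| / ε) ^ α⁻¹))
  have hn1 : 2 * (1 + a * C) / ε ≤ (((ℓ + 1) ^ k : ℕ) : ℝ) := le_trans (le_max_left _ _) hkX.le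
  have hn2 : 2 * |c₀| / ε < (((ℓ + 1) ^ k : ℕ) : ℝ) ^ α := by
    have hX0 : 0 ≤ (2 * |c₀| / ε) ^ α⁻¹ := Real.rpow_nonneg (div_nonneg (by positivity) hε0.le) _
    have hlt : (2 * |c₀| / ε) ^ α⁻¹ < (((ℓ + 1) ^ k : ℕ) : ℝ) := lt_of_le_of_lt (le_max_right _ _) hkX
    have h := Real.rpow_lt_rpow hX0 hlt hα
    rwa [Real.rpow_inv_rpow (div_nonneg (by positivity) hε0.le) hα.ne'] at h
  obtain ⟨hreg, hbig, hee⟩ := slab_hypotheses (ℓ := ℓ) hm2 a g k hk hMb μ e₁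
  exact ⟨_, hreg, hbig, hee, ineq112_slab_fails hℓ hm2 ha hMb hg k hk μ e₁
    (hC k hk (dblM Mb μ) (one_le_dblM hMb μ) μ Mb) hδ R₀ hn1 hn2⟩

/-- **NO CONSTANTS AT ALL FOR `α > 0`**: the `α`-clause of the restricted leaf `ThmPrintedNN` (∃ positive δ₀ c₀ R₀ e₁
with (1.9)–(1.12) for every member meeting the antecedents) fails on `nestFamB` for every `0 < α`. [folklore] -/
theorem leafClause_fails (hℓ : 1 ≤ ℓ) (hm2 : 0 ≤ m2plus) (ha : 0 < a) {Mb : ℕ} (hMb : 1 ≤ Mb)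
    {g : ∀ i : ZeroFieldInstance d, (↥i.R → ℝ) → ℝ} (hg : ∀ i f, 0 ≤ g i f) {α : ℝ} (hα : 0 < α) :
    ¬ ∃ δ₀ c₀ R₀ e₁ : ℝ, 0 < δ₀ ∧ 0 < c₀ ∧ 0 < R₀ ∧ 0 < e₁ ∧ ∀ i : NestInst d ℓ m2plus,
      (nestFamB ℓ m2plus a Mb g i).regular → (nestFamB ℓ m2plus a Mb g i).bigBlocks →
        0 < (nestFamB ℓ m2plus a Mb g i).e → (nestFamB ℓ m2plus a Mb g i).e ≤ e₁ →
          Ineq19_110 (nestFamB ℓ m2plus a Mb g i) α δ₀ c₀ R₀ ∧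
            Ineq111_112 (nestFamB ℓ m2plus a Mb g i) α δ₀ c₀ R₀ := by
  rintro ⟨δ₀, c₀, R₀, e₁, hδ, _, _, he, H⟩
  obtain ⟨i, hreg, hbig, hee, hnot⟩ := exists_member_violating hℓ hm2 ha hMb hg (0 : Fin (d + 1)) hα hδ.le c₀ R₀ e₁
  exact hnot (H i hreg hbig (hee ▸ he) hee.le).2

/-- **THE RESTRICTED LEAF `ThmPrintedNN` (Hölder range `0 ≤ α < 1`) IS FALSE ON b04's VERBATIM CARRIER OVER THE
NESTED-BOX FAMILY** (every `L ≥ 2`, `a > 0`, mass window `[0, m²₊]`, big-block size `Mb ≥ 1`, boundary assignment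
`g ≥ 0`): its clause `α = 1/2` fails. [cite: Balaban1983RegularityDecay, Theorem p. 573 (1.11)–(1.12), case A = 0 —
kernel refutation of the verbatim carrier's unguarded reading of `D^η_{A,μ}δG` at the face of `Ω`; NOT a claim
about the printed theorem] -/
theorem not_thmPrintedNN_nestFamB (hℓ : 1 ≤ ℓ) (hm2 : 0 ≤ m2plus) (ha : 0 < a) {Mb : ℕ} (hMb : 1 ≤ Mb)
    {g : ∀ i : ZeroFieldInstance d, (↥i.R → ℝ) → ℝ} (hg : ∀ i f, 0 ≤ g i f) :
    ¬ ThmPrintedNN (nestFamB (d := d) ℓ m2plus a Mb g) :=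
  fun H => leafClause_fails hℓ hm2 ha hMb hg (by norm_num : (0 : ℝ) < 1 / 2) (H (1 / 2) (by norm_num) (by norm_num))

/-- hence the cell's leaf `B4.ThmPrinted` (literal range «α < 1») fails there too. [folklore] -/
theorem not_thmPrinted_nestFamB (hℓ : 1 ≤ ℓ) (hm2 : 0 ≤ m2plus) (ha : 0 < a) {Mb : ℕ} (hMb : 1 ≤ Mb)
    {g : ∀ i : ZeroFieldInstance d, (↥i.R → ℝ) → ℝ} (hg : ∀ i f, 0 ≤ g i f) :
    ¬ ThmPrinted (nestFamB (d := d) ℓ m2plus a Mb g) :=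
  fun H => not_thmPrintedNN_nestFamB hℓ hm2 ha hMb hg (thmPrintedNN_of_thmPrinted _ H)

/-- **… AND OVER b04's OWN INDEX TYPE**: `ThmPrintedNN` fails for the verbatim carrier `zeroFieldSettingB a Mb g` on
ALL zero-field instances (`B4Cor23ZeroEta.ZeroFieldInstance d`), every `a > 0`, `Mb ≥ 1`, `g ≥ 0` — the refuting
member is the image `i.toZF` of `slab` (`L = 2`, `m² = 0 ∈ [0, 0]`). [cite: Balaban1983RegularityDecay, Theorem
p. 573 (1.11)–(1.12), case A = 0 — kernel refutation of the verbatim carrier's unguarded reading] -/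
theorem not_thmPrintedNN_zeroFieldSettingB (ha : 0 < a) {Mb : ℕ} (hMb : 1 ≤ Mb)
    {g : ∀ i : ZeroFieldInstance d, (↥i.R → ℝ) → ℝ} (hg : ∀ i f, 0 ≤ g i f) :
    ¬ ThmPrintedNN (zeroFieldSettingB a Mb g : ZeroFieldInstance d → EtaSetting) := by
  intro H
  obtain ⟨δ₀, c₀, R₀, e₁, hδ, _, _, he, H1⟩ := H (1 / 2) (by norm_num) (by norm_num)
  obtain ⟨i, hreg, hbig, hee, hnot⟩ :=
    exists_member_violating (d := d) (ℓ := 1) (m2plus := 0) le_rfl le_rfl ha hMb hg 0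
      (by norm_num : (0 : ℝ) < 1 / 2) hδ.le c₀ R₀ e₁
  exact hnot (H1 i.toZF hreg hbig (hee ▸ he) hee.le).2

/-- `dist_η(supp f, Ω₀∖Ω) ≥ 0`. [folklore] -/
theorem bdist_nonneg (i : ZeroFieldInstance d) (f : ↥i.R → ℝ) : 0 ≤ bdist i.n i.hsub f := by
  unfold bdist
  exact setDist_edistR_nonneg _ _

/-- **… IN PARTICULAR FOR b04's DEFAULT CARRIER `zeroFieldSetting a Mb`** (`bdistS = dist_η(supp f, Ω₀∖Ω)`), every
`a > 0`, `Mb ≥ 1`: the restricted leaf with the print's own Hölder range `0 ≤ α < 1` fails on it.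
[cite: Balaban1983RegularityDecay, Theorem p. 573 (1.11)–(1.12), case A = 0 — kernel refutation of the verbatim
carrier's unguarded reading] -/
theorem not_thmPrintedNN_zeroFieldSetting (ha : 0 < a) {Mb : ℕ} (hMb : 1 ≤ Mb) :
    ¬ ThmPrintedNN (zeroFieldSetting a Mb : ZeroFieldInstance d → EtaSetting) :=
  not_thmPrintedNN_zeroFieldSettingB ha hMb fun i f => bdist_nonneg i f

/-! ### The carrier dichotomy at `0 ≤ α < 1`: bond convention TRUE (node 13), verbatim convention FALSE (this file) -/

/-- **THE CONVENTION DICHOTOMY FOR (1.11)·(1.12) ON THE NESTED-BOX FAMILY.** With the default boundary assignment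
`g = dist_η(supp f, Ω₀∖Ω)` (admissible and nonnegative): the restricted leaf `ThmPrintedNN` HOLDS in node 12's
bond-convention carrier (`nestFam`, `B4Ineq111ZeroNestEta.thmPrintedNN_nestFam`) and FAILS in b04's verbatim carrier
(`nestFamB`) — the two carriers differ only in the unguarded Hölder fields `lhs19`/`dlhs19` at points whose forward
bond leaves `Ω` (OBSERVATION (O-bond)). [folklore] -/
theorem convention_dichotomy (hℓ : 1 ≤ ℓ) (hm2 : 0 ≤ m2plus) (ha : 0 < a) {Mb : ℕ} (hMb : 1 ≤ Mb) :
    ThmPrintedNN (nestFam (d := d) ℓ m2plus a Mb fun i f => bdist i.n i.hsub f) ∧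
      ¬ ThmPrintedNN (nestFamB (d := d) ℓ m2plus a Mb fun i f => bdist i.n i.hsub f) :=
  ⟨thmPrintedNN_nestFam hℓ a ha Mb bdist_admissible,
    not_thmPrintedNN_nestFamB hℓ hm2 ha hMb fun i f => bdist_nonneg i f⟩

end Refutation

/-! ## §7 Non-vacuity: the physical instance `d + 1 = 4`, `L = 2`, `a = 1`, unit big blocks -/

/-- the restricted leaf fails on the verbatim carrier over the nested-box family in four dimensions. -/
example : ¬ ThmPrintedNN (nestFamB (d := 3) 1 0 1 1 fun _ _ => 0) :=
  not_thmPrintedNN_nestFamB le_rfl le_rfl one_pos le_rfl fun _ _ => le_rfl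

/-- … while it holds on the bond-convention carrier over the same family (node 13). -/
example : ThmPrintedNN (nestFam (d := 3) 1 0 1 1 fun i f => bdist i.n i.hsub f) ∧
    ¬ ThmPrintedNN (nestFamB (d := 3) 1 0 1 1 fun i f => bdist i.n i.hsub f) :=
  convention_dichotomy le_rfl le_rfl one_pos le_rfl

/-- b04's default carrier on all four-dimensional zero-field instances. -/
example : ¬ ThmPrintedNN (zeroFieldSetting 1 1 : ZeroFieldInstance 3 → EtaSetting) :=
  not_thmPrintedNN_zeroFieldSetting one_pos le_rfl

end

end Literature.MathematicalPhysics.QuantumFieldTheory.Balaban1983to89.B4Ineq112ZeroNestNegFace
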